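import Literature.NumberTheory.EllipticCurves.UnramifiedLayerResidueProofs
import HarnessLib

/-!
# Kummer theory with an unramified twist in an unramified layer `K_v(ζ) ⊆ K̄_v`:
# counting `α ∈ L^×/(L^×)^{p^k}` with `F(α) ≡ α^e`

`Proofs` file (theorems only: no definition, no named fact) in topic
`NumberTheory/EllipticCurves`; a bottom-up brick for the one local input still missing for the
`K = ℚ` case of Mazur's control theorem, Greenberg's Lemma 3.4 at the layer `n = 0`
(`Literature.NumberTheory.EllipticCurves.Greenberg1999_coinvariantsRank_eq_selmerCorank_rat_of_ordinary_local_finiteness`,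
file `IwasawaSelmerControlAwayFromPProofs`; R. Greenberg, *Iwasawa theory for elliptic curves*,
LNM 1716 (1999), §3 Lemma 3.4, p. 89). In the elementary route to that lemma recorded in
`IwasawaLocalKummerSkeletonProofs` the only analytic input is the bound
`#H¹(ℚ_p, C[p^k]) ≤ c₀ · p^k` for the formal-group torsion `C = Ê[p^∞] ≅ ℚ_p/ℤ_p(χ φ⁻¹)` of a
good ordinary curve (`φ` the unramified character of `Ẽ[p^∞]`), i.e. "`H¹(ℚ_p, C)` has
`ℤ_p`-corank `≤ 1`" (Greenberg, §2, proof of Prop. 2.2, p. 73, there from Tate's local Euler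
characteristic formula and local duality). Over the unramified layer `L = K_v(ζ)` trivialising
`φ mod p^k`, `C[p^k] ≅ μ_{p^k}`, and by Kummer theory (Hilbert 90) the classes of `H¹(L, μ_{p^k})`
fixed by the twisted Frobenius are the classes `α ∈ L^×/(L^×)^{p^k}` with `F(α) ≡ α^e`, `e` the
unit by which `F` acts on `Ẽ[p^k]`. This file proves the LOCAL-FIELD count behind the corank
bound, by the unit filtration instead of the Euler characteristic formula:

* `exists_finset_forall_frobenius_zpow_rep` — for an unramified layer `L = K_v(ζ)` of `K̄_v`
  (`ζ` a primitive `(qⁿ - 1)`-th root of unity, `q = #k_v`), a prime `p` with `|p|_v < 1` which is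
  a uniformiser on `L` (`|x|_v < 1 ⇒ |x|_v ≤ |p|_v` on `L`: `v` unramified over `p`, e.g. `K = ℚ`),
  an arithmetic Frobenius `F`, an integer `e` and `k ≥ 0`: there is a finite set `R ⊆ L^×` with
  `#R ≤ N · q^{k+1}`, `N = #{x ∈ ℤ/p^k : (e - 1) x = 0}`, such that every `α ∈ L^×` with
  `F(α) α^{-e} ∈ (L^×)^{p^k}` lies in `r · (L^×)^{p^k}` for some `r ∈ R`.

## The argument (Serre, *Local Fields*, XIV §4 and V §3 style filtration counting)

Write `ρ = |p|_v`, `U_i = {x ∈ L : |x - 1| ≤ ρ^i}` (`i ≥ 1`), `P = {γ^{p^k} : γ ∈ 𝒪_L^×}`.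
1. *Valuations.* `|L^×| = ρ^ℤ`; `|F α| = |α|`; the valuation of a `p^k`-th power is divisible by
   `p^k`; so `α = p^m ε` with `ε` a unit, `(e - 1) m ≡ 0 (mod p^k)` (`N` choices of `m mod p^k`)
   and `F(ε) ε^{-e} ∈ P`.
2. *Units to principal units.* `ε^{qⁿ-1} ∈ U_1` (the residue field of `L` is `𝔽_{qⁿ}`) and
   `gcd(qⁿ - 1, p^k) = 1`, so `ε ≡ ε₁ (mod P)` with `ε₁ ∈ U_1`, `F(ε₁) ε₁^{-e} ∈ P`.
3. *`p`-th roots.* `U_{i+1} ⊆ (U_i)^p` for `i ≥ 2` (successive approximation in the complete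
   layer: `(1 + p^i a)^p = 1 + p^{i+1}(a + E(a))` with `E` a `ρ`-contraction of `𝒪_L`), hence
   `U_{k+2} ⊆ P`.
4. *Digits.* `U_i/U_{i+1} ↪ k̄_v`, `1 + p^i a ↦ ā`, additively, with `F ↦ (·)^q` and
   `(·)^e ↦ e·(·)`; the digits of `L` lie in `𝔽_{qⁿ}`.
5. *The count, level by level.* Let `S_j = {ε ∈ U_1 : F(ε)ε^{-e} ∈ U_j P}`. If `ε, ε₀ ∈ S_{j+1}`
   agree modulo `U_j P`, the digit `a` of `ε ε₀⁻¹ ∈ U_j P` (normalised into `U_j`) satisfies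
   `a^q - e a ∈ Δ_j`, the digits of `P ∩ U_j`, a subgroup of `𝔽_{qⁿ}` stable under
   `T : a ↦ a^q - e a`; and `T⁻¹(Δ_j)/Δ_j = ker(T̄ on 𝔽_{qⁿ}/Δ_j)` has
   `#coker T̄ ≤ #coker T = #ker T ≤ q` elements (`X^q - eX` has at most `q` roots). So each class
   of `S_j` modulo `U_j P` contains at most `q` classes of `S_{j+1}` modulo `U_{j+1} P`; starting
   from one class modulo `U_1 P` one reaches `≤ q^{k+1}` classes of `S_{k+2} ⊇ S` modulo
   `U_{k+2} P = P`.
For `e ≡ 1` (no twist: `C = μ`) the factor `N = p^k` recovers corank `2` for `H¹(ℚ_p, μ_{p^∞})`;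
for the formal group of an ordinary curve `e` is the unit root of Frobenius, `e ≠ 1`, and `N` is
bounded (`= #Ẽ(𝔽_p)[p^k]`), which is how ordinarity enters Lemma 3.4.

## References

* [GreenbergLNM1716] R. Greenberg, *Iwasawa theory for elliptic curves*, LNM 1716 (1999), §2
  Prop. 2.2 (proof, p. 73: "`H¹(M_η, C)` … has `ℤ_p`-corank"), §3 Lemma 3.4 (p. 89).
* [SerreLocalFields1979] J.-P. Serre, *Local Fields*, GTM 67 (1979), IV §4 Prop. 16, V §3
  (the filtration `U^{(i)}` and `(U^{(i)})^p`), XIV §4 (`K^×/K^{×n}`), X §3 (Hilbert 90 / Kummer).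
* J. W. S. Cassels, A. Fröhlich (eds.), *Algebraic Number Theory* (1967), Ch. I §6, Ch. VI §1.

## Design

No definitions; `noncomputable section`; one universe `u`. The layer is written
`IntermediateField.adjoin (v.adicCompletion K) {ζ}` as in `UnramifiedLayerRootsProofs`; the
spectral valuation `w` is quantified with `hw`; the residue map is used through a total function
`res : K̄_v → k̄_v` together with its specification on integral elements (derived from
`exists_residueMap`), so that digits can be named in statements without a definition.
-/

noncomputable section

open scoped Classical NNReal
open NumberField IsDedekindDomain

universe u

/-! ## §0 Pure algebra: preimages of a stable subgroup under an endomorphism of a finite group -/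

namespace Literature.NumberTheory.EllipticCurves.TwistedKummer

/-- **Coset counting for an endomorphism with a stable subgroup.** Let `Y` be a finite additive
group, `T` an endomorphism and `Δ ≤ Y` a subgroup with `T(Δ) ≤ Δ`. Then the elements `y` with
`T y ∈ Δ` lie in at most `#ker T` cosets of `Δ`: `T⁻¹(Δ)/Δ = ker(T̄ : Y/Δ → Y/Δ)` and
`#ker T̄ = #coker T̄ ≤ #coker T = #ker T`. [folklore] -/
theorem exists_finset_rep_of_map_mem {Y : Type*} [AddCommGroup Y] [Finite Y] (T : Y →+ Y)
    (Δ : AddSubgroup Y) (hΔ : ∀ y ∈ Δ, T y ∈ Δ) :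
    ∃ Rep : Finset Y, Rep.card ≤ Nat.card T.ker ∧ ∀ y : Y, T y ∈ Δ → ∃ ρ ∈ Rep, y - ρ ∈ Δ := by
  -- the induced endomorphism `T̄` of `Ȳ = Y/Δ`
  have hle : Δ ≤ Δ.comap T := fun y hy ↦ hΔ y hy
  let Tbar : Y ⧸ Δ →+ Y ⧸ Δ := QuotientAddGroup.map Δ Δ T hle
  have hTbar : ∀ y : Y, Tbar (QuotientAddGroup.mk y) = QuotientAddGroup.mk (T y) := fun y ↦ rfl
  haveI : Finite (Y ⧸ Δ) := inferInstance
  -- `#ker T̄ · #range T̄ = #Ȳ = #range T̄ · #coker T̄`, and `coker T̄` is a quotient of `coker T`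
  have hker : Nat.card Tbar.ker ≤ Nat.card T.ker := by
    -- `#ker T̄ = #(Ȳ / range T̄)`
    have h1 : Nat.card Tbar.ker * Nat.card Tbar.range = Nat.card (Y ⧸ Δ) := by
      rw [mul_comm, ← Nat.card_congr (QuotientAddGroup.quotientKerEquivRange Tbar).toEquiv]
      exact (Tbar.ker.card_eq_card_quotient_mul_card_addSubgroup).symm
    have h2 : Nat.card ((Y ⧸ Δ) ⧸ Tbar.range) * Nat.card Tbar.range = Nat.card (Y ⧸ Δ) :=
      (Tbar.range.card_eq_card_quotient_mul_card_addSubgroup).symm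
    have hr0 : 0 < Nat.card Tbar.range := Nat.card_pos
    have hk : Nat.card Tbar.ker = Nat.card ((Y ⧸ Δ) ⧸ Tbar.range) :=
      Nat.eq_of_mul_eq_mul_right hr0 (h1.trans h2.symm)
    -- similarly `#ker T = #(Y / range T)`
    have h3 : Nat.card T.ker * Nat.card T.range = Nat.card Y := by
      rw [mul_comm, ← Nat.card_congr (QuotientAddGroup.quotientKerEquivRange T).toEquiv]
      exact (T.ker.card_eq_card_quotient_mul_card_addSubgroup).symm
    have h4 : Nat.card (Y ⧸ T.range) * Nat.card T.range = Nat.card Y :=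
      (T.range.card_eq_card_quotient_mul_card_addSubgroup).symm
    have hr0' : 0 < Nat.card T.range := Nat.card_pos
    have hk' : Nat.card T.ker = Nat.card (Y ⧸ T.range) :=
      Nat.eq_of_mul_eq_mul_right hr0' (h3.trans h4.symm)
    rw [hk, hk']
    -- `Y / range T ↠ Ȳ / range T̄`
    let π : Y ⧸ T.range →+ (Y ⧸ Δ) ⧸ Tbar.range :=
      QuotientAddGroup.map T.range Tbar.range (QuotientAddGroup.mk' Δ) (by
        rintro _ ⟨y, rfl⟩
        exact ⟨QuotientAddGroup.mk y, hTbar y⟩)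
    have hπ : Function.Surjective π := by
      intro z
      obtain ⟨z', rfl⟩ := QuotientAddGroup.mk_surjective z
      obtain ⟨y, rfl⟩ := QuotientAddGroup.mk_surjective z'
      exact ⟨QuotientAddGroup.mk y, rfl⟩
    exact Nat.card_le_card_of_surjective π hπ
  -- representatives: lifts of the elements of `ker T̄`
  haveI : Fintype Tbar.ker := Fintype.ofFinite _
  refine ⟨Finset.univ.image fun κ : Tbar.ker ↦ Quotient.out (κ : Y ⧸ Δ), ?_, fun y hy ↦ ?_⟩
  · refine Finset.card_image_le.trans ?_
    rw [Finset.card_univ, ← Nat.card_eq_fintype_card]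
    exact hker
  · have hmem : (QuotientAddGroup.mk y : Y ⧸ Δ) ∈ Tbar.ker := by
      rw [AddMonoidHom.mem_ker, hTbar, QuotientAddGroup.eq_zero_iff]
      exact hy
    refine ⟨Quotient.out (QuotientAddGroup.mk y : Y ⧸ Δ),
      Finset.mem_image.mpr ⟨⟨_, hmem⟩, Finset.mem_univ _, rfl⟩, ?_⟩
    rw [← QuotientAddGroup.eq_iff_sub_mem, QuotientAddGroup.out_eq']

/-! ## §1 Ultrametric bookkeeping: principal units -/

section Units

variable {Ω : Type u} [Field Ω] (w : Valuation Ω ℝ≥0)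

/-- `|x| = 1` if `|x - 1| < 1`. [folklore] -/
theorem val_eq_one_of_val_sub_one_lt {x : Ω} (h : w (x - 1) < 1) : w x = 1 := by
  have := Valuation.map_add_eq_of_lt_left w (x := 1) (y := x - 1) (by rwa [map_one])
  rwa [map_one, add_sub_cancel] at this

/-- `|xy - 1| ≤ max(|x - 1|, |y - 1|)` for `|x| ≤ 1` (`xy - 1 = x(y - 1) + (x - 1)`). [folklore] -/
theorem val_mul_sub_one_le {x y : Ω} (hx : w x ≤ 1) :
    w (x * y - 1) ≤ max (w (x - 1)) (w (y - 1)) := by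
  have e : x * y - 1 = x * (y - 1) + (x - 1) := by ring
  rw [e, max_comm]
  refine (Valuation.map_add w _ _).trans (max_le_max ?_ le_rfl)
  rw [map_mul]
  exact mul_le_of_le_one_left' hx

/-- `|xy - 1| ≤ t` if `|x - 1|, |y - 1| ≤ t ≤ 1`... precisely: if `|x - 1| ≤ t`, `|y - 1| ≤ t` and
`t < 1`. [folklore] -/
theorem val_mul_sub_one_le_of_le {x y : Ω} {t : ℝ≥0} (ht : t < 1) (hx : w (x - 1) ≤ t)
    (hy : w (y - 1) ≤ t) : w (x * y - 1) ≤ t :=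
  (val_mul_sub_one_le w (val_eq_one_of_val_sub_one_lt w (hx.trans_lt ht)).le).trans (max_le hx hy)

/-- `|x⁻¹ - 1| = |x - 1|` if `|x - 1| < 1`. [folklore] -/
theorem val_inv_sub_one {x : Ω} (h : w (x - 1) < 1) : w (x⁻¹ - 1) = w (x - 1) := by
  have hx1 := val_eq_one_of_val_sub_one_lt w h
  have hx0 : x ≠ 0 := fun h0 ↦ by rw [h0, map_zero] at hx1; exact zero_ne_one hx1
  have e : x⁻¹ - 1 = -(x⁻¹ * (x - 1)) := by field_simp; ring
  rw [e, Valuation.map_neg, map_mul, map_inv₀, hx1, inv_one, one_mul]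

/-- `|x^n - 1| ≤ t` if `|x - 1| ≤ t < 1`. [folklore] -/
theorem val_pow_sub_one_le {x : Ω} {t : ℝ≥0} (ht : t < 1) (hx : w (x - 1) ≤ t) (n : ℕ) :
    w (x ^ n - 1) ≤ t := by
  induction n with
  | zero => rw [pow_zero, sub_self, map_zero]; exact zero_le
  | succ n ih => rw [pow_succ]; exact val_mul_sub_one_le_of_le w ht ih hx

/-- `|x^e - 1| ≤ t` for an integer `e` if `|x - 1| ≤ t < 1`. [folklore] -/
theorem val_zpow_sub_one_le {x : Ω} {t : ℝ≥0} (ht : t < 1) (hx : w (x - 1) ≤ t) (e : ℤ) :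
    w (x ^ e - 1) ≤ t := by
  rcases Int.eq_nat_or_neg e with ⟨n, rfl | rfl⟩
  · rw [zpow_natCast]; exact val_pow_sub_one_le w ht hx n
  · rw [zpow_neg, zpow_natCast, ← inv_pow]
    refine val_pow_sub_one_le w ht ?_ n
    rwa [val_inv_sub_one w (hx.trans_lt ht)]

end Units

/-! ## §2 The value group of an unramified layer and `p`-th roots of principal units -/

section Layer

variable {Ω : Type u} [Field Ω] (w : Valuation Ω ℝ≥0) (L : Subfield Ω) (p : ℕ)
  (hp1 : w (p : Ω) < 1) (hp0 : 0 < w (p : Ω))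
  (hdisc : ∀ x ∈ L, w x < 1 → w x ≤ w (p : Ω))

include hp1 hp0 hdisc in
/-- **The value group of the layer is `|p|^ℤ`**: every non-zero `x ∈ L` has `|x| = |p|^m` for an
integer `m` (from `|x| < 1 ⇒ |x| ≤ |p|` on `L`: pick `m` with `|p|^{m+1} < |x| ≤ |p|^m` and look at
`x p^{-m} ∈ L`). Serre, *Local Fields*, II §3; Neukirch II (7.5). [folklore] -/
theorem exists_val_eq_zpow {x : Ω} (hxL : x ∈ L) (hx : x ≠ 0) : ∃ m : ℤ, w x = w (p : Ω) ^ m := by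
  have hx0 : 0 < w x := (Valuation.pos_iff w).mpr hx
  have hρ1 : (1 : ℝ) < ((w (p : Ω))⁻¹ : ℝ≥0) := by
    rw [NNReal.coe_inv]; exact one_lt_inv₀ (by exact_mod_cast hp0) |>.mpr (by exact_mod_cast hp1)
  obtain ⟨n, hn1, hn2⟩ := exists_mem_Ioc_zpow (by exact_mod_cast hx0 : (0 : ℝ) < w x) hρ1
  -- `|p|^{-n-1} ≥ |x| > |p|^{-n}` hmm: `((|p|⁻¹)^n < |x| ≤ (|p|⁻¹)^(n+1))`
  have hpne : (w (p : Ω)) ≠ 0 := hp0.ne'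
  have h1 : w (p : Ω) ^ (-n) < w x := by
    have : ((w (p : Ω))⁻¹ : ℝ≥0) ^ n < w x := by exact_mod_cast hn1
    rwa [inv_zpow', ] at this
  have h2 : w x ≤ w (p : Ω) ^ (-(n + 1)) := by
    have : w x ≤ ((w (p : Ω))⁻¹ : ℝ≥0) ^ (n + 1) := by exact_mod_cast hn2
    rwa [inv_zpow'] at this
  -- normalise: `y = x p^{n+1}` has `|p| < |y| ≤ 1`
  set y : Ω := x * (p : Ω) ^ (n + 1) with hy
  have hp0' : (p : Ω) ≠ 0 := fun h ↦ by rw [h, map_zero] at hp0; exact lt_irrefl _ hp0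
  have hyL : y ∈ L := L.mul_mem hxL (L.zpow_mem (natCast_mem L p) _)
  have hwy : w y = w x * w (p : Ω) ^ (n + 1) := by rw [hy, map_mul, map_zpow₀]
  have hy1 : w y ≤ 1 := by
    rw [hwy]
    calc w x * w (p : Ω) ^ (n + 1) ≤ w (p : Ω) ^ (-(n + 1)) * w (p : Ω) ^ (n + 1) :=
          mul_le_mul' h2 le_rfl
      _ = 1 := by rw [← zpow_add₀ hpne, neg_add_cancel, zpow_zero]
  have hylow : w (p : Ω) < w y := by
    rw [hwy]
    calc w (p : Ω) = w (p : Ω) ^ (-n) * w (p : Ω) ^ (n + 1) := by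
          rw [← zpow_add₀ hpne, show -n + (n + 1) = (1 : ℤ) by ring, zpow_one]
      _ < w x * w (p : Ω) ^ (n + 1) := by
          exact mul_lt_mul_of_pos_right h1 (zpow_pos hp0 _)
  have hy_eq : w y = 1 := by
    rcases hy1.lt_or_eq with hlt | heq
    · exact absurd (hdisc y hyL hlt) (not_le.mpr hylow)
    · exact heq
  refine ⟨-(n + 1), ?_⟩
  have : w x = w y * w (p : Ω) ^ (-(n + 1)) := by
    rw [hwy, mul_assoc, ← zpow_add₀ hpne, add_neg_cancel, zpow_zero, mul_one]
  rw [this, hy_eq, one_mul]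

include hp1 hp0 in
/-- `m ↦ |p|^m` is injective. [folklore] -/
theorem zpow_val_injective : Function.Injective fun m : ℤ ↦ w (p : Ω) ^ m :=
  zpow_right_injective₀ hp0 hp1.ne

end Layer

/-! ## §3 `p`-th roots of principal units: `U_{i+1} ⊆ (U_i)^p` for `i ≥ 2` -/

section Roots

variable {Ω : Type u} [Field Ω] (w : Valuation Ω ℝ≥0) (L : Subfield Ω) (p : ℕ)
  (hp1 : w (p : Ω) < 1) (hp0 : 0 < w (p : Ω))
  (hcomplete : ∀ (ρ : ℝ≥0), ρ < 1 → ∀ x : ℕ → Ω, (∀ r, x r ∈ L) →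
    (∀ r, w (x (r + 1) - x r) ≤ ρ ^ (r + 1)) → ∃ y ∈ L, ∀ r, w (y - x r) ≤ ρ ^ (r + 1))

/-- The binomial error term: `(1 + p^i a)^p = 1 + p^{i+1} (a + E_i(a))` with
`E_i(a) = ((1 + p^i a)^p - 1) p^{-(i+1)} - a`. [folklore] -/
theorem one_add_pow_prime_eq (hp0' : (p : Ω) ≠ 0) (i : ℕ) (a : Ω) :
    (1 + (p : Ω) ^ i * a) ^ p =
      1 + (p : Ω) ^ (i + 1) * (a + (((1 + (p : Ω) ^ i * a) ^ p - 1) * ((p : Ω) ^ (i + 1))⁻¹ - a)) := by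
  have hpi : (p : Ω) ^ (i + 1) ≠ 0 := pow_ne_zero _ hp0'
  field_simp
  ring

include hp1 in
/-- **The error term is a contraction**: for `|a|, |a'| ≤ 1` and `i ≥ 2`,
`|E_i(a) - E_i(a')| ≤ |p| · |a - a'|`. Indeed `(1 + p^i a)^p - (1 + p^i a')^p = p^i (a - a') S` with
`S = Σ_{l<p} (1 + p^i a)^l (1 + p^i a')^{p-1-l} ≡ p (mod p^i)`, so
`E_i(a) - E_i(a') = (a - a')(S - p)/p`. [folklore] -/
theorem val_errorTerm_sub_le (hp0' : (p : Ω) ≠ 0) {i : ℕ} (hi : 2 ≤ i) {a a' : Ω} (ha : w a ≤ 1)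
    (ha' : w a' ≤ 1) :
    w ((((1 + (p : Ω) ^ i * a) ^ p - 1) * ((p : Ω) ^ (i + 1))⁻¹ - a) -
        (((1 + (p : Ω) ^ i * a') ^ p - 1) * ((p : Ω) ^ (i + 1))⁻¹ - a')) ≤
      w (p : Ω) * w (a - a') := by
  set P : Ω := (p : Ω) with hP
  set X : Ω := 1 + P ^ i * a with hX
  set Y : Ω := 1 + P ^ i * a' with hY
  set S : Ω := ∑ l ∈ Finset.range p, X ^ l * Y ^ (p - 1 - l) with hS
  have hgeom : S * (X - Y) = X ^ p - Y ^ p := Commute.geom_sum₂_mul (Commute.all X Y) p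
  have hXY : X - Y = P ^ i * (a - a') := by rw [hX, hY]; ring
  have hPi : P ^ (i + 1) ≠ 0 := pow_ne_zero _ hp0'
  -- the algebraic identity
  have e : ((X ^ p - 1) * (P ^ (i + 1))⁻¹ - a) - ((Y ^ p - 1) * (P ^ (i + 1))⁻¹ - a') =
      (a - a') * (S - p) * P⁻¹ := by
    have h1 : (X ^ p - 1) - (Y ^ p - 1) = S * (P ^ i * (a - a')) := by rw [← hXY, hgeom]; ring
    have h2 : ((X ^ p - 1) * (P ^ (i + 1))⁻¹ - a) - ((Y ^ p - 1) * (P ^ (i + 1))⁻¹ - a') =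
        ((X ^ p - 1) - (Y ^ p - 1)) * (P ^ (i + 1))⁻¹ - (a - a') := by ring
    rw [h2, h1]
    field_simp
    ring
  rw [e, map_mul, map_mul, map_inv₀]
  -- `|S - p| ≤ |p|^i`
  have hρi : w P ^ i < 1 := pow_lt_one₀ zero_le hp1 (by omega)
  have hX1 : w (X - 1) ≤ w P ^ i := by
    rw [hX, add_sub_cancel_left, map_mul, map_pow]
    exact mul_le_of_le_one_right' ha
  have hY1 : w (Y - 1) ≤ w P ^ i := by
    rw [hY, add_sub_cancel_left, map_mul, map_pow]
    exact mul_le_of_le_one_right' ha'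
  have hSp : w (S - p) ≤ w P ^ i := by
    have hsum : S - p = ∑ l ∈ Finset.range p, (X ^ l * Y ^ (p - 1 - l) - 1) := by
      rw [Finset.sum_sub_distrib, Finset.sum_const, Finset.card_range, nsmul_eq_mul, mul_one]
    rw [hsum]
    refine Valuation.map_sum_le w fun l _ ↦ ?_
    have h1 := val_pow_sub_one_le w hρi hX1 l
    have h2 := val_pow_sub_one_le w hρi hY1 (p - 1 - l)
    exact val_mul_sub_one_le_of_le w hρi h1 h2
  -- assemble: `|a - a'| |S - p| / |p| ≤ |a - a'| |p|^{i-1} ≤ |p| |a - a'|`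
  have hPpos : 0 < w P := lt_of_le_of_ne zero_le (fun h ↦ hp0' ((Valuation.zero_iff w).mp h.symm))
  obtain ⟨j, rfl⟩ := Nat.exists_eq_add_of_le hi
  calc w (a - a') * w (S - ↑p) * (w P)⁻¹ ≤ w (a - a') * w P ^ (2 + j) * (w P)⁻¹ := by
        gcongr
    _ = w P * w (a - a') * w P ^ j := by
        rw [pow_add, pow_two]; field_simp
    _ ≤ w P * w (a - a') := by
        exact mul_le_of_le_one_right' (pow_le_one₀ zero_le hp1.le)

include hp1 hp0 hcomplete in
/-- **`p`-th roots of deep principal units** (`U_{i+1} ⊆ (U_i)^p` for `i ≥ 2`): if `y ∈ L` has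
`|y - 1| ≤ |p|^{i+1}` with `i ≥ 2`, then `y = x^p` for some `x ∈ L` with `|x - 1| ≤ |p|^i`. Proof by
successive approximation in the complete layer: with `b = (y - 1)/p^{i+1}` solve `a + E_i(a) = b`
by iterating the contraction `a ↦ b - E_i(a)` and put `x = 1 + p^i a`. Serre, *Local Fields*,
V §3 Lemma 2 / XIV §4 (there via the logarithm; here directly). [cite: SerreLocalFields1979, Ch. V §3] -/
theorem exists_pow_prime_eq_of_val_sub_one_le {i : ℕ} (hi : 2 ≤ i) {y : Ω} (hyL : y ∈ L)
    (hy : w (y - 1) ≤ w (p : Ω) ^ (i + 1)) :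
    ∃ x ∈ L, w (x - 1) ≤ w (p : Ω) ^ i ∧ x ^ p = y := by
  set P : Ω := (p : Ω) with hP
  have hp0' : P ≠ 0 := fun h ↦ by rw [h, map_zero] at hp0; exact lt_irrefl _ hp0
  have hPi : ∀ n : ℕ, P ^ n ≠ 0 := fun n ↦ pow_ne_zero _ hp0'
  have hPL : P ∈ L := natCast_mem L p
  -- the error term and its properties
  let E : Ω → Ω := fun a ↦ ((1 + P ^ i * a) ^ p - 1) * (P ^ (i + 1))⁻¹ - a
  have hE0 : E 0 = 0 := by simp [E]
  have hEL : ∀ a ∈ L, E a ∈ L := fun a ha ↦ by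
    refine L.sub_mem (L.mul_mem (L.sub_mem (L.pow_mem (L.add_mem L.one_mem
      (L.mul_mem (L.pow_mem hPL i) ha)) p) L.one_mem) (L.inv_mem (L.pow_mem hPL _))) ha
  have hElip : ∀ a a', w a ≤ 1 → w a' ≤ 1 → w (E a - E a') ≤ w P * w (a - a') :=
    fun a a' ha ha' ↦ val_errorTerm_sub_le w p hp1 hp0' hi ha ha'
  have hEint : ∀ a, w a ≤ 1 → w (E a) ≤ w P := fun a ha ↦ by
    have := hElip a 0 ha (by rw [map_zero]; exact zero_le_one)
    rw [hE0, sub_zero, sub_zero] at this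
    exact this.trans (mul_le_of_le_one_right' ha)
  -- the target `b`
  set b : Ω := (y - 1) * (P ^ (i + 1))⁻¹ with hb
  have hbL : b ∈ L := L.mul_mem (L.sub_mem hyL L.one_mem) (L.inv_mem (L.pow_mem hPL _))
  have hb1 : w b ≤ 1 := by
    rw [hb, map_mul, map_inv₀, map_pow]
    have hpos : 0 < w P ^ (i + 1) := pow_pos hp0 _
    calc w (y - 1) * (w P ^ (i + 1))⁻¹ ≤ w P ^ (i + 1) * (w P ^ (i + 1))⁻¹ := by gcongr
      _ = 1 := mul_inv_cancel₀ hpos.ne'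
  -- the iteration
  obtain ⟨a, ha0, hasucc⟩ : ∃ a : ℕ → Ω, a 0 = b ∧ ∀ n, a (n + 1) = b - E (a n) :=
    ⟨fun n ↦ Nat.rec b (fun _ an ↦ b - E an) n, rfl, fun n ↦ rfl⟩
  have haL : ∀ n, a n ∈ L := fun n ↦ by
    induction n with
    | zero => rw [ha0]; exact hbL
    | succ n ih => rw [hasucc]; exact L.sub_mem hbL (hEL _ ih)
  have haint : ∀ n, w (a n) ≤ 1 := fun n ↦ by
    induction n with
    | zero => rw [ha0]; exact hb1
    | succ n ih =>
      rw [hasucc]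
      exact (Valuation.map_sub w _ _).trans (max_le hb1 ((hEint _ ih).trans hp1.le))
  have hdiff : ∀ n, w (a (n + 1) - a n) ≤ w P ^ (n + 1) := fun n ↦ by
    induction n with
    | zero =>
      rw [hasucc, ha0, zero_add, pow_one, sub_sub_cancel_left, Valuation.map_neg]
      exact hEint b hb1
    | succ n ih =>
      rw [hasucc (n + 1), hasucc n,
        show b - E (b - E (a n)) - (b - E (a n)) = -(E (b - E (a n)) - E (a n)) by ring,
        Valuation.map_neg, ← hasucc n]
      refine (hElip _ _ (haint _) (haint _)).trans ?_
      rw [pow_succ']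
      exact mul_le_mul' le_rfl ih
  -- the limit and the fixed point
  obtain ⟨α, hαL, hα⟩ := hcomplete (w P) hp1 a haL hdiff
  have hαint : w α ≤ 1 := by
    have h := hα 0
    rw [ha0, zero_add, pow_one] at h
    have : α = (α - b) + b := by ring
    rw [this]
    exact (Valuation.map_add w _ _).trans (max_le (h.trans hp1.le) hb1)
  have hfix : α = b - E α := by
    rw [← sub_eq_zero]
    by_contra hne
    have hpos : 0 < w (α - (b - E α)) := (Valuation.pos_iff w).mpr hne
    obtain ⟨n, hn⟩ := exists_pow_lt_of_lt_one hpos hp1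
    have hle : w (α - (b - E α)) ≤ w P ^ (n + 2) := by
      have e : α - (b - E α) = (α - a (n + 1)) + (E α - E (a n)) := by rw [hasucc]; ring
      rw [e]
      refine (Valuation.map_add w _ _).trans (max_le (hα (n + 1)) ?_)
      refine (hElip _ _ hαint (haint n)).trans ?_
      rw [show n + 2 = (n + 1) + 1 by ring, pow_succ']
      exact mul_le_mul' le_rfl (hα n)
    have : w P ^ (n + 2) ≤ w P ^ n := pow_le_pow_right_of_le_one' hp1.le (by omega)
    exact absurd ((hle.trans this).trans_lt hn) (lt_irrefl _)
  -- `x = 1 + p^i α`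
  refine ⟨1 + P ^ i * α, L.add_mem L.one_mem (L.mul_mem (L.pow_mem hPL i) hαL), ?_, ?_⟩
  · rw [add_sub_cancel_left, map_mul, map_pow]
    exact mul_le_of_le_one_right' hαint
  · rw [one_add_pow_prime_eq p hp0' i α]
    change 1 + P ^ (i + 1) * (α + E α) = y
    have hsum : α + E α = b := by linear_combination hfix
    rw [hsum, hb, mul_comm (y - 1), ← mul_assoc, mul_inv_cancel₀ (hPi _), one_mul, add_sub_cancel]

include hp1 hp0 hcomplete in
/-- **`U_{k+2} ⊆ (U_2)^{p^k}`**: an element `y ∈ L` with `|y - 1| ≤ |p|^{k+2}` is a `p^k`-th power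
of some `x ∈ L` with `|x - 1| ≤ |p|²` (iterate the previous statement). Serre, *Local Fields*, V §3,
XIV §4. [cite: SerreLocalFields1979, Ch. XIV §4] -/
theorem exists_pow_prime_pow_eq_of_val_sub_one_le (k : ℕ) {y : Ω} (hyL : y ∈ L)
    (hy : w (y - 1) ≤ w (p : Ω) ^ (k + 2)) :
    ∃ x ∈ L, w (x - 1) ≤ w (p : Ω) ^ 2 ∧ x ^ p ^ k = y := by
  induction k generalizing y with
  | zero => exact ⟨y, hyL, by simpa using hy, by rw [pow_zero, pow_one]⟩
  | succ k ih =>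
    obtain ⟨x₁, hx₁L, hx₁, rfl⟩ := exists_pow_prime_eq_of_val_sub_one_le w L p hp1 hp0 hcomplete
      (i := k + 2) (by omega) hyL (by rwa [show k + 2 + 1 = k + 1 + 2 by ring])
    obtain ⟨x, hxL, hx, rfl⟩ := ih hx₁L hx₁
    exact ⟨x, hxL, hx, by rw [pow_succ, pow_mul]⟩

end Roots

/-! ## §4 Digits: `U_i/U_{i+1} ↪ k̄`, `1 + p^i a ↦ ā` -/

section Digits

variable {Ω : Type u} [Field Ω] (w : Valuation Ω ℝ≥0) (L : Subfield Ω) (p : ℕ)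
  (hp1 : w (p : Ω) < 1) (hp0 : 0 < w (p : Ω))
  (hdisc : ∀ x ∈ L, w x < 1 → w x ≤ w (p : Ω))
  {k : Type*} [Field k] (res : Ω → k)
  (hres_add : ∀ x y, w x ≤ 1 → w y ≤ 1 → res (x + y) = res x + res y)
  (hres_lt : ∀ x, w x ≤ 1 → (res x = 0 ↔ w x < 1))

include hp0 in
/-- `p ≠ 0` in `Ω`. [folklore] -/
theorem natCast_prime_ne_zero : (p : Ω) ≠ 0 := fun h ↦ by
  rw [h, map_zero] at hp0; exact lt_irrefl _ hp0

include hp0 in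
/-- **Integrality of the digit argument**: `|(u - 1) p^{-i}| ≤ 1` if `|u - 1| ≤ |p|^i`. [folklore] -/
theorem val_digitArg_le_one {i : ℕ} {u : Ω} (hu : w (u - 1) ≤ w (p : Ω) ^ i) :
    w ((u - 1) * ((p : Ω) ^ i)⁻¹) ≤ 1 := by
  rw [map_mul, map_inv₀, map_pow]
  have hpos : 0 < w (p : Ω) ^ i := pow_pos hp0 _
  calc w (u - 1) * (w (p : Ω) ^ i)⁻¹ ≤ w (p : Ω) ^ i * (w (p : Ω) ^ i)⁻¹ := by gcongr
    _ = 1 := mul_inv_cancel₀ hpos.ne'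

include hp0 in
/-- The digit argument in terms of `u`: `u = 1 + p^i · ((u - 1) p^{-i})`. [folklore] -/
theorem eq_one_add_pow_mul_digitArg (i : ℕ) (u : Ω) :
    u = 1 + (p : Ω) ^ i * ((u - 1) * ((p : Ω) ^ i)⁻¹) := by
  have := pow_ne_zero i (natCast_prime_ne_zero w p hp0)
  field_simp
  ring

include hres_lt in
/-- `res 0 = 0`. [folklore] -/
theorem res_zero : res 0 = 0 :=
  (hres_lt 0 (by rw [map_zero]; exact zero_le_one)).mpr (by rw [map_zero]; exact zero_lt_one)

include hp1 hp0 hres_add hres_lt in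
/-- **Digits are additive**: for `|u - 1|, |u' - 1| ≤ |p|^i` with `i ≥ 1`, the digit of `u u'` is
the sum of the digits (`(uu' - 1)p^{-i} = (u-1)p^{-i} + (u'-1)p^{-i} + p^i · (u-1)p^{-i} · (u'-1)p^{-i}`).
Serre, *Local Fields*, IV §2 Prop. 6. [cite: SerreLocalFields1979, Ch. IV §2 Prop. 6] -/
theorem res_digitArg_mul {i : ℕ} (hi : 1 ≤ i) {u u' : Ω} (hu : w (u - 1) ≤ w (p : Ω) ^ i)
    (hu' : w (u' - 1) ≤ w (p : Ω) ^ i) :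
    res ((u * u' - 1) * ((p : Ω) ^ i)⁻¹) =
      res ((u - 1) * ((p : Ω) ^ i)⁻¹) + res ((u' - 1) * ((p : Ω) ^ i)⁻¹) := by
  set P : Ω := (p : Ω) with hP
  set a : Ω := (u - 1) * (P ^ i)⁻¹ with ha
  set a' : Ω := (u' - 1) * (P ^ i)⁻¹ with ha'
  have hPi : P ^ i ≠ 0 := pow_ne_zero i (natCast_prime_ne_zero w p hp0)
  have ha1 : w a ≤ 1 := val_digitArg_le_one w p hp0 hu
  have ha'1 : w a' ≤ 1 := val_digitArg_le_one w p hp0 hu'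
  have e : (u * u' - 1) * (P ^ i)⁻¹ = (a + a') + P ^ i * a * a' := by
    rw [eq_one_add_pow_mul_digitArg w p hp0 i u, eq_one_add_pow_mul_digitArg w p hp0 i u']
    rw [← ha, ← ha']
    field_simp
    ring
  have hc : w (P ^ i * a * a') < 1 := by
    rw [map_mul, map_mul, map_pow]
    calc w P ^ i * w a * w a' ≤ w P ^ i * 1 * 1 := by gcongr
      _ = w P ^ i := by rw [mul_one, mul_one]
      _ < 1 := pow_lt_one₀ zero_le hp1 (by omega)
  have haa' : w (a + a') ≤ 1 := (Valuation.map_add w _ _).trans (max_le ha1 ha'1)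
  rw [e, hres_add _ _ haa' hc.le, hres_add _ _ ha1 ha'1, (hres_lt _ hc.le).mpr hc, add_zero]

include hres_lt in
/-- The digit of `1` is `0`. [folklore] -/
theorem res_digitArg_one (i : ℕ) : res (((1 : Ω) - 1) * ((p : Ω) ^ i)⁻¹) = 0 := by
  rw [sub_self, zero_mul]; exact res_zero w res hres_lt

include hp1 hp0 hres_add hres_lt in
/-- Digits of inverses: the digit of `u⁻¹` is minus the digit of `u`. [folklore] -/
theorem res_digitArg_inv {i : ℕ} (hi : 1 ≤ i) {u : Ω} (hu : w (u - 1) ≤ w (p : Ω) ^ i) :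
    res ((u⁻¹ - 1) * ((p : Ω) ^ i)⁻¹) = -res ((u - 1) * ((p : Ω) ^ i)⁻¹) := by
  have hlt : w (u - 1) < 1 := hu.trans_lt (pow_lt_one₀ zero_le hp1 (by omega))
  have hu1 := val_eq_one_of_val_sub_one_lt w hlt
  have hu0 : u ≠ 0 := fun h ↦ by rw [h, map_zero] at hu1; exact zero_ne_one hu1
  have hui : w (u⁻¹ - 1) ≤ w (p : Ω) ^ i := by rwa [val_inv_sub_one w hlt]
  have h := res_digitArg_mul w p hp1 hp0 res hres_add hres_lt hi hu hui
  rw [mul_inv_cancel₀ hu0, res_digitArg_one w p res hres_lt] at h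
  exact (neg_eq_of_add_eq_zero_right h.symm).symm

include hp1 hp0 hres_add hres_lt in
/-- Digits of powers: the digit of `u^n` is `n` times the digit of `u`. [folklore] -/
theorem res_digitArg_pow {i : ℕ} (hi : 1 ≤ i) {u : Ω} (hu : w (u - 1) ≤ w (p : Ω) ^ i) (n : ℕ) :
    res ((u ^ n - 1) * ((p : Ω) ^ i)⁻¹) = n * res ((u - 1) * ((p : Ω) ^ i)⁻¹) := by
  have hρi : w (p : Ω) ^ i < 1 := pow_lt_one₀ zero_le hp1 (by omega)
  induction n with
  | zero => rw [pow_zero, res_digitArg_one w p res hres_lt, Nat.cast_zero, zero_mul]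
  | succ n ih =>
    rw [pow_succ, res_digitArg_mul w p hp1 hp0 res hres_add hres_lt hi
      (val_pow_sub_one_le w hρi hu n) hu, ih, Nat.cast_succ]
    ring

include hp1 hp0 hres_add hres_lt in
/-- Digits of integer powers: the digit of `u^e` is `e` times the digit of `u`. [folklore] -/
theorem res_digitArg_zpow {i : ℕ} (hi : 1 ≤ i) {u : Ω} (hu : w (u - 1) ≤ w (p : Ω) ^ i) (e : ℤ) :
    res ((u ^ e - 1) * ((p : Ω) ^ i)⁻¹) = e * res ((u - 1) * ((p : Ω) ^ i)⁻¹) := by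
  have hρi : w (p : Ω) ^ i < 1 := pow_lt_one₀ zero_le hp1 (by omega)
  rcases Int.eq_nat_or_neg e with ⟨n, rfl | rfl⟩
  · rw [zpow_natCast, res_digitArg_pow w p hp1 hp0 res hres_add hres_lt hi hu n,
      Int.cast_natCast]
  · rw [zpow_neg, zpow_natCast, res_digitArg_inv w p hp1 hp0 res hres_add hres_lt hi
      (val_pow_sub_one_le w hρi hu n),
      res_digitArg_pow w p hp1 hp0 res hres_add hres_lt hi hu n, Int.cast_neg,
      Int.cast_natCast, neg_mul]

/-- Digits and a Frobenius: if `F` fixes `p` then `(F u - 1)p^{-i} = F((u - 1)p^{-i})`. [folklore] -/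
theorem digitArg_map (F : Ω →+* Ω) (i : ℕ) (u : Ω) :
    (F u - 1) * ((p : Ω) ^ i)⁻¹ = F ((u - 1) * ((p : Ω) ^ i)⁻¹) := by
  rw [map_mul, map_sub, map_one, map_inv₀, map_pow, map_natCast]

include hp1 hp0 hdisc hres_lt in
/-- **The digit vanishes iff the unit is deeper**: for `u ∈ L` with `|u - 1| ≤ |p|^i`, the digit of
`u` is `0` iff `|u - 1| ≤ |p|^{i+1}` (discreteness of `L`). [folklore] -/
theorem res_digitArg_eq_zero_iff {i : ℕ} {u : Ω} (huL : u ∈ L) (hu : w (u - 1) ≤ w (p : Ω) ^ i) :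
    res ((u - 1) * ((p : Ω) ^ i)⁻¹) = 0 ↔ w (u - 1) ≤ w (p : Ω) ^ (i + 1) := by
  have hp0' := natCast_prime_ne_zero w p hp0
  have hPi : (p : Ω) ^ i ≠ 0 := pow_ne_zero i hp0'
  have hposi : 0 < w (p : Ω) ^ i := pow_pos hp0 _
  have haL : (u - 1) * ((p : Ω) ^ i)⁻¹ ∈ L :=
    L.mul_mem (L.sub_mem huL L.one_mem) (L.inv_mem (L.pow_mem (natCast_mem L p) i))
  rw [hres_lt _ (val_digitArg_le_one w p hp0 hu)]
  constructor
  · intro hlt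
    have hle := hdisc _ haL hlt
    rw [map_mul, map_inv₀, map_pow] at hle
    rw [pow_succ]
    calc w (u - 1) = w (u - 1) * (w (p : Ω) ^ i)⁻¹ * w (p : Ω) ^ i := by
          rw [inv_mul_cancel_right₀ hposi.ne']
      _ ≤ w (p : Ω) * w (p : Ω) ^ i := mul_le_mul' hle le_rfl
      _ = w (p : Ω) ^ i * w (p : Ω) := mul_comm _ _
  · intro hle
    rw [map_mul, map_inv₀, map_pow]
    calc w (u - 1) * (w (p : Ω) ^ i)⁻¹ ≤ w (p : Ω) ^ (i + 1) * (w (p : Ω) ^ i)⁻¹ := by gcongr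
      _ = w (p : Ω) := by rw [pow_succ, mul_assoc, mul_comm (w (p : Ω)), ← mul_assoc,
          mul_inv_cancel₀ hposi.ne', one_mul]
      _ < 1 := hp1

end Digits

/-! ## §5 `p^m`-th powers of units of the layer and the twisted-eigen count, level by level -/

section Count

variable {Ω : Type u} [Field Ω] (w : Valuation Ω ℝ≥0) (L : Subfield Ω) (p : ℕ)
  (hp1 : w (p : Ω) < 1) (hp0 : 0 < w (p : Ω))
  (hdisc : ∀ x ∈ L, w x < 1 → w x ≤ w (p : Ω))
  (F : Ω →+* Ω) (hFw : ∀ x, w (F x) = w x) (hFL : ∀ x ∈ L, F x ∈ L)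
  {k : Type*} [Field k] (res : Ω → k) (q n : ℕ) (hq : 2 ≤ q) (hn : n ≠ 0)
  (hres_add : ∀ x y, w x ≤ 1 → w y ≤ 1 → res (x + y) = res x + res y)
  (hres_lt : ∀ x, w x ≤ 1 → (res x = 0 ↔ w x < 1))
  (hres_F : ∀ x, w x ≤ 1 → res (F x) = res x ^ q)
  (hres_L : ∀ x ∈ L, w x ≤ 1 → res x ^ q ^ n = res x)
  (hpow_add : ∀ a b : k, (a + b) ^ q = a ^ q + b ^ q)
  (m : ℕ) (e : ℤ)

/-! ### `p^m`-th powers of units -/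

/-- `1` is a `p^m`-th power of a unit of `L`. [folklore] -/
theorem isPk_one : ∃ γ ∈ L, w γ = 1 ∧ γ ^ p ^ m = (1 : Ω) := ⟨1, L.one_mem, map_one w, one_pow _⟩

/-- Products of `p^m`-th powers of units are such. [folklore] -/
theorem isPk_mul {π π' : Ω} (hπ : ∃ γ ∈ L, w γ = 1 ∧ γ ^ p ^ m = π)
    (hπ' : ∃ γ ∈ L, w γ = 1 ∧ γ ^ p ^ m = π') : ∃ γ ∈ L, w γ = 1 ∧ γ ^ p ^ m = π * π' := by
  obtain ⟨γ, hγL, hγ, rfl⟩ := hπ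
  obtain ⟨γ', hγ'L, hγ', rfl⟩ := hπ'
  exact ⟨γ * γ', L.mul_mem hγL hγ'L, by rw [map_mul, hγ, hγ', one_mul], mul_pow _ _ _⟩

/-- Inverses of `p^m`-th powers of units are such. [folklore] -/
theorem isPk_inv {π : Ω} (hπ : ∃ γ ∈ L, w γ = 1 ∧ γ ^ p ^ m = π) :
    ∃ γ ∈ L, w γ = 1 ∧ γ ^ p ^ m = π⁻¹ := by
  obtain ⟨γ, hγL, hγ, rfl⟩ := hπ
  exact ⟨γ⁻¹, L.inv_mem hγL, by rw [map_inv₀, hγ, inv_one], inv_pow _ _⟩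

include hFw hFL in
/-- The twist `F(π) π^{-e}` of a `p^m`-th power of a unit is such. [folklore] -/
theorem isPk_twist {π : Ω} (hπ : ∃ γ ∈ L, w γ = 1 ∧ γ ^ p ^ m = π) :
    ∃ γ ∈ L, w γ = 1 ∧ γ ^ p ^ m = F π * (π ^ e)⁻¹ := by
  obtain ⟨γ, hγL, hγ, rfl⟩ := hπ
  refine ⟨F γ * (γ ^ e)⁻¹, L.mul_mem (hFL γ hγL) (L.inv_mem (L.zpow_mem hγL e)), ?_, ?_⟩
  · rw [map_mul, map_inv₀, map_zpow₀, hFw, hγ, one_zpow, inv_one, mul_one]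
  · rw [mul_pow, map_pow, inv_pow, ← zpow_natCast (γ ^ e), ← zpow_mul, mul_comm e,
      zpow_mul, zpow_natCast]

/-- A `p^m`-th power of a unit has valuation `1`, lies in `L` and is non-zero. [folklore] -/
theorem val_eq_one_of_isPk {π : Ω} (hπ : ∃ γ ∈ L, w γ = 1 ∧ γ ^ p ^ m = π) :
    w π = 1 ∧ π ∈ L ∧ π ≠ 0 := by
  obtain ⟨γ, hγL, hγ, rfl⟩ := hπ
  refine ⟨by rw [map_pow, hγ, one_pow], L.pow_mem hγL _, pow_ne_zero _ fun h ↦ ?_⟩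
  rw [h, map_zero] at hγ; exact zero_ne_one hγ

include hpow_add in
/-- Additivity of `a ↦ a^{qⁿ}` on `k`. [folklore] -/
theorem pow_pow_add (j : ℕ) (a b : k) : (a + b) ^ q ^ j = a ^ q ^ j + b ^ q ^ j := by
  induction j with
  | zero => rw [pow_zero, pow_one, pow_one, pow_one]
  | succ j ih => rw [pow_succ, pow_mul, ih, hpow_add, ← pow_mul, ← pow_mul]

include hpow_add hq in
/-- `a ↦ a^{qⁿ}` commutes with negation. [folklore] -/
theorem neg_pow_pow (j : ℕ) (a : k) : (-a) ^ q ^ j = -(a ^ q ^ j) := by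
  have h := pow_pow_add q hpow_add j a (-a)
  rw [add_neg_cancel, zero_pow (pow_ne_zero j (by omega))] at h
  exact (neg_eq_of_add_eq_zero_right h.symm).symm

include hpow_add hq in
/-- Integers are fixed by `a ↦ a^q` (they lie in the prime field). [folklore] -/
theorem intCast_pow_eq (z : ℤ) : ((z : k)) ^ q = z := by
  have hnat : ∀ j : ℕ, ((j : k)) ^ q = j := fun j ↦ by
    induction j with
    | zero => rw [Nat.cast_zero, zero_pow (by omega)]
    | succ j ih => rw [Nat.cast_succ, hpow_add, ih, one_pow]
  rcases Int.eq_nat_or_neg z with ⟨j, rfl | rfl⟩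
  · rw [Int.cast_natCast, hnat]
  · have h := neg_pow_pow q hq hpow_add 1 (j : k)
    rw [pow_one] at h
    rw [Int.cast_neg, Int.cast_natCast, h, hnat]

include hpow_add hq in
/-- The twisted Frobenius `T(a) = a^q - e a` preserves `{a : a^{qⁿ} = a}`. [folklore] -/
theorem twistMap_mem (e : ℤ) {a : k} (ha : a ^ q ^ n = a) :
    (a ^ q - e * a) ^ q ^ n = a ^ q - e * a := by
  have he : ∀ j : ℕ, ((e : k)) ^ q ^ j = e := fun j ↦ by
    induction j with
    | zero => rw [pow_zero, pow_one]
    | succ j ih => rw [pow_succ, pow_mul, ih, intCast_pow_eq q hq hpow_add]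
  rw [sub_eq_add_neg, pow_pow_add q hpow_add, neg_pow_pow q hq hpow_add, mul_pow, he, ← pow_mul,
    mul_comm q, pow_mul, ha, ← sub_eq_add_neg]

include hFw in
/-- `|F x - 1| = |x - 1|` when `F` is an isometry fixing `1`. [folklore] -/
theorem val_map_sub_one (x : Ω) : w (F x - 1) = w (x - 1) := by
  rw [← hFw (x - 1), map_sub F, map_one F]

include hFw in
/-- The twist `F(x) x^{-e}` of a principal unit of level `t` is one. [folklore] -/
theorem val_twist_sub_one_le {x : Ω} {t : ℝ≥0} (ht : t < 1) (hx : w (x - 1) ≤ t) :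
    w (F x * (x ^ e)⁻¹ - 1) ≤ t := by
  refine val_mul_sub_one_le_of_le w ht (by rwa [val_map_sub_one w F hFw]) ?_
  rw [← zpow_neg]
  exact val_zpow_sub_one_le w ht hx _

include hp1 hp0 hFw hres_add hres_lt hres_F in
/-- **The digit of the twist**: for `|u - 1| ≤ |p|^j` (`j ≥ 1`) the digit of `F(u) u^{-e}` is
`a^q - e a`, `a` the digit of `u`. [folklore] -/
theorem res_digitArg_twist {j : ℕ} (hj : 1 ≤ j) {u : Ω} (hu : w (u - 1) ≤ w (p : Ω) ^ j) :
    res ((F u * (u ^ e)⁻¹ - 1) * ((p : Ω) ^ j)⁻¹) =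
      res ((u - 1) * ((p : Ω) ^ j)⁻¹) ^ q - e * res ((u - 1) * ((p : Ω) ^ j)⁻¹) := by
  have hρj : w (p : Ω) ^ j < 1 := pow_lt_one₀ zero_le hp1 (by omega)
  have hFu : w (F u - 1) ≤ w (p : Ω) ^ j := by rwa [val_map_sub_one w F hFw]
  have hue : w ((u ^ e)⁻¹ - 1) ≤ w (p : Ω) ^ j := by
    rw [← zpow_neg]; exact val_zpow_sub_one_le w hρj hu _
  rw [res_digitArg_mul w p hp1 hp0 res hres_add hres_lt hj hFu hue, ← zpow_neg,
    res_digitArg_zpow w p hp1 hp0 res hres_add hres_lt hj hu, digitArg_map p F j u,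
    hres_F _ (val_digitArg_le_one w p hp0 hu), Int.cast_neg, neg_mul, ← sub_eq_add_neg]

include hp1 hp0 hdisc hFw hFL hq hn hres_add hres_lt hres_F hres_L hpow_add in
/-- **The fibre step.** Fix `j ≥ 1` and a principal unit `r ∈ L`. Among the principal units
`ε ∈ L` with `F(ε) ε^{-e} ∈ U_{j+1} P` (`P` the `p^m`-th powers of units of `L`) which are
`≡ r (mod U_j P)`, there are at most `q` classes modulo `U_{j+1} P`: normalising `ε r⁻¹` into
`U_j` by an element of `P`, its digit `a` has `(a - a₀)^q - e (a - a₀) ∈ Δ_j` (the digits of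
`P ∩ U_j`) for a fixed `a₀`, and the cosets of `Δ_j` containing such `a - a₀` number at most
`#ker(a ↦ a^q - e a) ≤ q` (`exists_finset_rep_of_map_mem` in `𝔽_{qⁿ}`). Serre, *Local Fields*,
XIV §4 (the filtration of `K^×/K^{×n}`). [cite: SerreLocalFields1979, Ch. XIV §4] -/
theorem exists_finset_fibre {j : ℕ} (hj : 1 ≤ j) {r : Ω} (hrL : r ∈ L) (hr : w (r - 1) ≤ w (p : Ω)) :
    ∃ T : Finset Ω, T.card ≤ q ∧ (∀ t ∈ T, t ∈ L ∧ w (t - 1) ≤ w (p : Ω)) ∧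
      ∀ ε : Ω, ε ∈ L → w (ε - 1) ≤ w (p : Ω) →
        (∃ π : Ω, (∃ γ ∈ L, w γ = 1 ∧ γ ^ p ^ m = π) ∧
          w (F ε * (ε ^ e)⁻¹ * π⁻¹ - 1) ≤ w (p : Ω) ^ (j + 1)) →
        (∃ π : Ω, (∃ γ ∈ L, w γ = 1 ∧ γ ^ p ^ m = π) ∧ w (ε * r⁻¹ * π⁻¹ - 1) ≤ w (p : Ω) ^ j) →
          ∃ t ∈ T, ∃ π : Ω, (∃ γ ∈ L, w γ = 1 ∧ γ ^ p ^ m = π) ∧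
            w (ε * t⁻¹ * π⁻¹ - 1) ≤ w (p : Ω) ^ (j + 1) := by
  -- notation and basic facts
  set P : Ω := (p : Ω) with hPdef
  have hp0' : P ≠ 0 := natCast_prime_ne_zero w p hp0
  have hPL : P ∈ L := natCast_mem L p
  have hρj : w P ^ j < 1 := pow_lt_one₀ zero_le hp1 (by omega)
  have hρj1 : w P ^ (j + 1) < 1 := pow_lt_one₀ zero_le hp1 (by omega)
  have hρjj : w P ^ (j + 1) ≤ w P ^ j := pow_le_pow_right_of_le_one' hp1.le (by omega)
  have hr1 : w (r - 1) < 1 := hr.trans_lt hp1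
  have hr0 : r ≠ 0 := fun h ↦ by
    have := val_eq_one_of_val_sub_one_lt w hr1; rw [h, map_zero] at this; exact zero_ne_one this
  -- abbreviations (propositions)
  let IsPk : Ω → Prop := fun π ↦ ∃ γ ∈ L, w γ = 1 ∧ γ ^ p ^ m = π
  let dig : Ω → k := fun u ↦ res ((u - 1) * (P ^ j)⁻¹)
  have hPk1 : ∀ {π}, IsPk π → w π = 1 ∧ π ∈ L ∧ π ≠ 0 := fun hπ ↦ val_eq_one_of_isPk w L p m hπ
  -- (Y) the finite additive group `{a : a^{qⁿ} = a}`
  let Y : AddSubgroup k :=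
    { carrier := {a | a ^ q ^ n = a}
      zero_mem' := by simp [zero_pow (pow_ne_zero n (by omega : q ≠ 0))]
      add_mem' := fun {a b} ha hb ↦ by
        simp only [Set.mem_setOf_eq] at ha hb ⊢
        rw [pow_pow_add q hpow_add, ha, hb]
      neg_mem' := fun {a} ha ↦ by
        simp only [Set.mem_setOf_eq] at ha ⊢
        rw [neg_pow_pow q hq hpow_add, ha] }
  have hYmem : ∀ a : k, a ∈ Y ↔ a ^ q ^ n = a := fun a ↦ Iff.rfl
  haveI : Finite Y := by
    have hqn : 1 < q ^ n := Nat.one_lt_pow hn (by omega)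
    have hfin : Set.Finite {a : k | a ^ q ^ n = a} := by
      refine (((Polynomial.X ^ q ^ n - Polynomial.X : Polynomial k)).roots.toFinset.finite_toSet).subset ?_
      intro a ha
      simp only [Set.mem_setOf_eq] at ha
      simp only [Finset.mem_coe, Multiset.mem_toFinset]
      rw [Polynomial.mem_roots (FiniteField.X_pow_card_sub_X_ne_zero k hqn), Polynomial.IsRoot,
        Polynomial.eval_sub, Polynomial.eval_pow, Polynomial.eval_X, ha, sub_self]
    exact Set.Finite.to_subtype hfin
  -- (T) the twisted Frobenius on `Y`
  let T : Y →+ Y :=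
    { toFun := fun y ↦ ⟨(y : k) ^ q - e * y, (hYmem _).mpr (twistMap_mem q n hq hpow_add e y.2)⟩
      map_zero' := Subtype.ext (by simp [zero_pow (by omega : q ≠ 0)])
      map_add' := fun a b ↦ Subtype.ext (by
        simp only [AddSubgroup.coe_add, AddMemClass.mk_add_mk]
        rw [hpow_add]; ring) }
  have hT : ∀ y : Y, ((T y : Y) : k) = (y : k) ^ q - e * y := fun y ↦ rfl
  -- `#ker T ≤ q`
  have hkerT : Nat.card T.ker ≤ q := by
    let f : Polynomial k := Polynomial.X ^ q - Polynomial.C (e : k) * Polynomial.X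
    have hf : f ≠ 0 := by
      intro h
      have := congrArg Polynomial.natDegree h
      rw [Polynomial.natDegree_zero] at this
      have hdeg : f.natDegree = q := by
        rw [Polynomial.natDegree_sub_eq_left_of_natDegree_lt, Polynomial.natDegree_X_pow]
        rw [Polynomial.natDegree_X_pow]
        refine (Polynomial.natDegree_C_mul_le _ _).trans_lt ?_
        rw [Polynomial.natDegree_X]; omega
      omega
    let ι : T.ker → f.roots.toFinset := fun y ↦ ⟨((y : Y) : k), by
      rw [Multiset.mem_toFinset, Polynomial.mem_roots hf, Polynomial.IsRoot]
      have hy : T y = 0 := y.2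
      have hy' : ((y : Y) : k) ^ q - e * ((y : Y) : k) = 0 := by
        rw [← hT]; exact congrArg Subtype.val hy
      simp [f, hy']⟩
    have hι : Function.Injective ι := fun a b h ↦
      Subtype.ext (Subtype.ext (congrArg Subtype.val h :))
    calc Nat.card T.ker ≤ Nat.card f.roots.toFinset := Nat.card_le_card_of_injective ι hι
      _ = f.roots.toFinset.card := Nat.card_eq_finsetCard _
      _ ≤ Multiset.card f.roots := Multiset.toFinset_card_le _
      _ ≤ f.natDegree := Polynomial.card_roots' f
      _ ≤ q := by
          refine (Polynomial.natDegree_sub_le _ _).trans (max_le ?_ ?_)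
          · rw [Polynomial.natDegree_X_pow]
          · refine (Polynomial.natDegree_C_mul_le _ _).trans ?_
            rw [Polynomial.natDegree_X]; omega
  -- level-`j` facts about the digit map `dig`
  have hdig_mem : ∀ u ∈ L, w (u - 1) ≤ w P ^ j → dig u ∈ Y := fun u huL hu ↦
    (hYmem _).mpr (hres_L _ (L.mul_mem (L.sub_mem huL L.one_mem)
      (L.inv_mem (L.pow_mem hPL j))) (val_digitArg_le_one w p hp0 hu))
  have hdig_mul : ∀ {u u'}, w (u - 1) ≤ w P ^ j → w (u' - 1) ≤ w P ^ j →
      dig (u * u') = dig u + dig u' := fun hu hu' ↦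
    res_digitArg_mul w p hp1 hp0 res hres_add hres_lt hj hu hu'
  have hdig_inv : ∀ {u}, w (u - 1) ≤ w P ^ j → dig u⁻¹ = -dig u := fun hu ↦
    res_digitArg_inv w p hp1 hp0 res hres_add hres_lt hj hu
  have hdig_zero : ∀ {u}, u ∈ L → w (u - 1) ≤ w P ^ j → (dig u = 0 ↔ w (u - 1) ≤ w P ^ (j + 1)) :=
    fun huL hu ↦ res_digitArg_eq_zero_iff w L p hp1 hp0 hdisc res hres_lt huL hu
  have hdig_twist : ∀ {u}, w (u - 1) ≤ w P ^ j →
      dig (F u * (u ^ e)⁻¹) = dig u ^ q - e * dig u := fun hu ↦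
    res_digitArg_twist w p hp1 hp0 F hFw res q hres_add hres_lt hres_F e hj hu
  have hU_mul : ∀ {u u'}, w (u - 1) ≤ w P ^ j → w (u' - 1) ≤ w P ^ j → w (u * u' - 1) ≤ w P ^ j :=
    fun hu hu' ↦ val_mul_sub_one_le_of_le w hρj hu hu'
  have hU_inv : ∀ {u}, w (u - 1) ≤ w P ^ j → w (u⁻¹ - 1) ≤ w P ^ j := fun hu ↦ by
    rwa [val_inv_sub_one w (hu.trans_lt hρj)]
  have hU_twist : ∀ {u}, w (u - 1) ≤ w P ^ j → w (F u * (u ^ e)⁻¹ - 1) ≤ w P ^ j := fun hu ↦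
    val_twist_sub_one_le w F hFw e hρj hu
  have hU_ne : ∀ {u}, w (u - 1) ≤ w P ^ j → u ≠ 0 := fun hu h ↦ by
    have := val_eq_one_of_val_sub_one_lt w (hu.trans_lt hρj)
    rw [h, map_zero] at this; exact zero_ne_one this
  -- (Δ) the digits of `P ∩ U_j`, an additive subgroup of `Y` stable under `T`
  let Δ : AddSubgroup Y :=
    { carrier := {a | ∃ π : Ω, IsPk π ∧ w (π - 1) ≤ w P ^ j ∧ dig π = (a : k)}
      zero_mem' := ⟨1, isPk_one w L p m, by rw [sub_self, map_zero]; exact zero_le,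
        by rw [ZeroMemClass.coe_zero]; exact res_digitArg_one w p res hres_lt j⟩
      add_mem' := by
        rintro a b ⟨π, hπ, hπ1, hπd⟩ ⟨π', hπ', hπ'1, hπ'd⟩
        exact ⟨π * π', isPk_mul w L p m hπ hπ', hU_mul hπ1 hπ'1, by
          rw [hdig_mul hπ1 hπ'1, hπd, hπ'd, AddSubgroup.coe_add]⟩
      neg_mem' := by
        rintro a ⟨π, hπ, hπ1, hπd⟩
        exact ⟨π⁻¹, isPk_inv w L p m hπ, hU_inv hπ1, by
          rw [hdig_inv hπ1, hπd, AddSubgroup.coe_neg]⟩ }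
  have hΔmem : ∀ a : Y, a ∈ Δ ↔ ∃ π : Ω, IsPk π ∧ w (π - 1) ≤ w P ^ j ∧ dig π = (a : k) :=
    fun a ↦ Iff.rfl
  have hΔT : ∀ a ∈ Δ, T a ∈ Δ := by
    rintro a ⟨π, hπ, hπ1, hπd⟩
    exact ⟨F π * (π ^ e)⁻¹, isPk_twist w L p F hFw hFL m e hπ, hU_twist hπ1, by
      rw [hdig_twist hπ1, hπd, hT]⟩
  -- representatives of `T⁻¹(Δ)` modulo `Δ`
  obtain ⟨Rep, hRep, hRepP⟩ := exists_finset_rep_of_map_mem T Δ hΔT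
  -- (A) the digit relation between two admissible `ε, ε'`
  have hsub_pow : ∀ a b : k, (a - b) ^ q = a ^ q - b ^ q := fun a b ↦ by
    have h := neg_pow_pow q hq hpow_add 1 b
    rw [pow_one] at h
    rw [sub_eq_add_neg, hpow_add, h, ← sub_eq_add_neg]
  have hA : ∀ {ε ε' πc πc' π π' : Ω}, ε ∈ L → ε' ∈ L → IsPk πc → IsPk πc' → IsPk π → IsPk π' →
      w (F ε * (ε ^ e)⁻¹ * πc⁻¹ - 1) ≤ w P ^ (j + 1) →
      w (F ε' * (ε' ^ e)⁻¹ * πc'⁻¹ - 1) ≤ w P ^ (j + 1) →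
      w (ε * r⁻¹ * π⁻¹ - 1) ≤ w P ^ j → w (ε' * r⁻¹ * π'⁻¹ - 1) ≤ w P ^ j →
      ∃ π'' : Ω, IsPk π'' ∧ w (π'' - 1) ≤ w P ^ j ∧
        dig π'' = (dig (ε * r⁻¹ * π⁻¹) ^ q - e * dig (ε * r⁻¹ * π⁻¹)) -
          (dig (ε' * r⁻¹ * π'⁻¹) ^ q - e * dig (ε' * r⁻¹ * π'⁻¹)) := by
    intro ε ε' πc πc' π π' hεL hε'L hπc hπc' hπ hπ' hc hc' hu hu'
    obtain ⟨-, hπcL, hπc0⟩ := hPk1 hπc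
    obtain ⟨-, hπc'L, hπc'0⟩ := hPk1 hπc'
    obtain ⟨-, hπL, hπ0⟩ := hPk1 hπ
    obtain ⟨-, hπ'L, hπ'0⟩ := hPk1 hπ'
    have hε0 : ε ≠ 0 := by
      intro h; rw [h, zero_mul, zero_mul, zero_sub, Valuation.map_neg, map_one] at hu
      exact absurd hu (not_le.mpr hρj)
    have hε'0 : ε' ≠ 0 := by
      intro h; rw [h, zero_mul, zero_mul, zero_sub, Valuation.map_neg, map_one] at hu'
      exact absurd hu' (not_le.mpr hρj)
    set u : Ω := ε * r⁻¹ * π⁻¹ with hudef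
    set u' : Ω := ε' * r⁻¹ * π'⁻¹ with hu'def
    set uc : Ω := F ε * (ε ^ e)⁻¹ * πc⁻¹ with hucdef
    set uc' : Ω := F ε' * (ε' ^ e)⁻¹ * πc'⁻¹ with huc'def
    set tw : Ω := F (π' * π⁻¹) * ((π' * π⁻¹) ^ e)⁻¹ with htwdef
    set z : Ω := F (u * u'⁻¹) * ((u * u'⁻¹) ^ e)⁻¹ with hzdef
    have hFε0 : F ε ≠ 0 := (map_ne_zero F).mpr hε0
    have hFε'0 : F ε' ≠ 0 := (map_ne_zero F).mpr hε'0
    have hFr0 : F r ≠ 0 := (map_ne_zero F).mpr hr0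
    have hFπ0 : F π ≠ 0 := (map_ne_zero F).mpr hπ0
    have hFπ'0 : F π' ≠ 0 := (map_ne_zero F).mpr hπ'0
    have huc0 : uc ≠ 0 := hU_ne (hc.trans hρjj)
    have huc'0 : uc' ≠ 0 := hU_ne (hc'.trans hρjj)
    -- the algebraic identity `z = uc uc'⁻¹ · (πc πc'⁻¹ tw)`
    have hz_eq : z = (uc * uc'⁻¹) * (πc * πc'⁻¹ * tw) := by
      have h1 : F ε * (ε ^ e)⁻¹ = uc * πc := by
        rw [hucdef, inv_mul_cancel_right₀ hπc0]
      have h2 : F ε' * (ε' ^ e)⁻¹ = uc' * πc' := by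
        rw [huc'def, inv_mul_cancel_right₀ hπc'0]
      have h3 : z = (F ε * (ε ^ e)⁻¹) * (F ε' * (ε' ^ e)⁻¹)⁻¹ * tw := by
        rw [hzdef, htwdef, hudef, hu'def]
        simp only [map_mul, map_inv₀, mul_zpow, inv_zpow, mul_inv, inv_inv]
        field_simp
      rw [h3, h1, h2]
      field_simp
    have hz : w (z - 1) ≤ w P ^ j := hU_twist (hU_mul hu (hU_inv hu'))
    have hucuc : w (uc * uc'⁻¹ - 1) ≤ w P ^ (j + 1) :=
      val_mul_sub_one_le_of_le w hρj1 hc (by rwa [val_inv_sub_one w (hc'.trans_lt hρj1)])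
    have hucucL : uc * uc'⁻¹ ∈ L :=
      L.mul_mem (L.mul_mem (L.mul_mem (hFL ε hεL) (L.inv_mem (L.zpow_mem hεL e)))
        (L.inv_mem hπcL)) (L.inv_mem (L.mul_mem (L.mul_mem (hFL ε' hε'L)
          (L.inv_mem (L.zpow_mem hε'L e))) (L.inv_mem hπc'L)))
    refine ⟨πc * πc'⁻¹ * tw, isPk_mul w L p m (isPk_mul w L p m hπc (isPk_inv w L p m hπc'))
      (isPk_twist w L p F hFw hFL m e (isPk_mul w L p m hπ' (isPk_inv w L p m hπ))), ?_, ?_⟩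
    · have e1 : πc * πc'⁻¹ * tw = z * (uc * uc'⁻¹)⁻¹ := by
        rw [hz_eq, mul_comm (uc * uc'⁻¹) _,
          mul_inv_cancel_right₀ (mul_ne_zero huc0 (inv_ne_zero huc'0))]
      rw [e1]
      exact hU_mul hz (hU_inv (hucuc.trans hρjj))
    · have e1 : πc * πc'⁻¹ * tw = z * (uc * uc'⁻¹)⁻¹ := by
        rw [hz_eq, mul_comm (uc * uc'⁻¹) _,
          mul_inv_cancel_right₀ (mul_ne_zero huc0 (inv_ne_zero huc'0))]
      have hd0 : dig (uc * uc'⁻¹)⁻¹ = 0 := by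
        rw [hdig_inv (hucuc.trans hρjj), neg_eq_zero, hdig_zero hucucL (hucuc.trans hρjj)]
        exact hucuc
      rw [e1, hdig_mul hz (hU_inv (hucuc.trans hρjj)), hd0, add_zero, hzdef,
        hdig_twist (hU_mul hu (hU_inv hu')), hdig_mul hu (hU_inv hu'), hdig_inv hu', ← sub_eq_add_neg,
        hsub_pow, mul_sub]
      ring
  -- (B) equal digits modulo `Δ` give congruence modulo `U_{j+1} P`
  have hB : ∀ {ε ε' π π' π₅ : Ω}, IsPk π → IsPk π' → IsPk π₅ → ε' ∈ L → ε ∈ L →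
      w (ε * r⁻¹ * π⁻¹ - 1) ≤ w P ^ j → w (ε' * r⁻¹ * π'⁻¹ - 1) ≤ w P ^ j →
      w (π₅ - 1) ≤ w P ^ j → dig π₅ = dig (ε * r⁻¹ * π⁻¹) - dig (ε' * r⁻¹ * π'⁻¹) →
      ∃ π₃ : Ω, IsPk π₃ ∧ w (ε * ε'⁻¹ * π₃⁻¹ - 1) ≤ w P ^ (j + 1) := by
    intro ε ε' π π' π₅ hπ hπ' hπ₅ hε'L hεL hu hu' h5 hd
    obtain ⟨-, hπL, hπ0⟩ := hPk1 hπ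
    obtain ⟨-, hπ'L, hπ'0⟩ := hPk1 hπ'
    obtain ⟨-, hπ₅L, hπ₅0⟩ := hPk1 hπ₅
    have hε'0 : ε' ≠ 0 := by
      intro h
      have hu'' := hu'
      rw [h, zero_mul, zero_mul, zero_sub, Valuation.map_neg, map_one] at hu''
      exact absurd hu'' (not_le.mpr hρj)
    set x : Ω := (ε * r⁻¹ * π⁻¹) * (ε' * r⁻¹ * π'⁻¹)⁻¹ * π₅⁻¹ with hxdef
    have hx : w (x - 1) ≤ w P ^ j := hU_mul (hU_mul hu (hU_inv hu')) (hU_inv h5)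
    have hxL : x ∈ L := L.mul_mem (L.mul_mem (L.mul_mem (L.mul_mem hεL (L.inv_mem hrL))
      (L.inv_mem hπL)) (L.inv_mem (L.mul_mem (L.mul_mem hε'L (L.inv_mem hrL))
        (L.inv_mem hπ'L)))) (L.inv_mem hπ₅L)
    have hdx : dig x = 0 := by
      rw [hxdef, hdig_mul (hU_mul hu (hU_inv hu')) (hU_inv h5), hdig_mul hu (hU_inv hu'),
        hdig_inv hu', hdig_inv h5, hd]
      ring
    have hx1 : w (x - 1) ≤ w P ^ (j + 1) := (hdig_zero hxL hx).mp hdx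
    refine ⟨π * π'⁻¹ * π₅, isPk_mul w L p m (isPk_mul w L p m hπ (isPk_inv w L p m hπ')) hπ₅, ?_⟩
    have e1 : ε * ε'⁻¹ * (π * π'⁻¹ * π₅)⁻¹ = x := by
      rw [hxdef]; field_simp
    rwa [e1]
  -- (C) the base point and the representatives
  by_cases hex : ∃ ε₀ πc₀ π₀ : Ω, ε₀ ∈ L ∧ IsPk πc₀ ∧ IsPk π₀ ∧
      w (F ε₀ * (ε₀ ^ e)⁻¹ * πc₀⁻¹ - 1) ≤ w P ^ (j + 1) ∧ w (ε₀ * r⁻¹ * π₀⁻¹ - 1) ≤ w P ^ j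
  swap
  · refine ⟨∅, by simp, by simp, ?_⟩
    rintro ε hεL - ⟨πc, hπc, hc⟩ ⟨π, hπ, hu⟩
    exact absurd ⟨ε, πc, π, hεL, hπc, hπ, hc, hu⟩ hex
  obtain ⟨ε₀, πc₀, π₀, hε₀L, hπc₀, hπ₀, hc₀, hu₀⟩ := hex
  let a₀ : Y := ⟨dig (ε₀ * r⁻¹ * π₀⁻¹), hdig_mem _ (L.mul_mem (L.mul_mem hε₀L (L.inv_mem hrL))
    (L.inv_mem (hPk1 hπ₀).2.1)) hu₀⟩
  -- the relation `REL ε ρ'`: some normalisation of `ε r⁻¹` has digit `≡ a₀ + ρ' (mod Δ)`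
  let REL : Ω → Y → Prop := fun ε ρ' ↦ ∃ π : Ω, ∃ hπ : IsPk π,
    ∃ hu : w (ε * r⁻¹ * π⁻¹ - 1) ≤ w P ^ j, ∃ hεL : ε ∈ L,
      (⟨dig (ε * r⁻¹ * π⁻¹), hdig_mem _ (L.mul_mem (L.mul_mem hεL (L.inv_mem hrL))
        (L.inv_mem (hPk1 hπ).2.1)) hu⟩ : Y) - a₀ - ρ' ∈ Δ
  -- (C1) every admissible `ε` is related to some representative
  have hC1 : ∀ ε : Ω, ε ∈ L →
      (∃ π : Ω, IsPk π ∧ w (F ε * (ε ^ e)⁻¹ * π⁻¹ - 1) ≤ w P ^ (j + 1)) →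
      (∃ π : Ω, IsPk π ∧ w (ε * r⁻¹ * π⁻¹ - 1) ≤ w P ^ j) → ∃ ρ' ∈ Rep, REL ε ρ' := by
    rintro ε hεL ⟨πc, hπc, hc⟩ ⟨π, hπ, hu⟩
    let y : Y := ⟨dig (ε * r⁻¹ * π⁻¹), hdig_mem _ (L.mul_mem (L.mul_mem hεL (L.inv_mem hrL))
      (L.inv_mem (hPk1 hπ).2.1)) hu⟩ - a₀
    have hy : T y ∈ Δ := by
      obtain ⟨π'', hπ'', h1, hd⟩ := hA hεL hε₀L hπc hπc₀ hπ hπ₀ hc hc₀ hu hu₀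
      refine (hΔmem _).mpr ⟨π'', hπ'', h1, ?_⟩
      rw [hd, map_sub, AddSubgroup.coe_sub, hT, hT]
    obtain ⟨ρ', hρ', hyρ⟩ := hRepP y hy
    exact ⟨ρ', hρ', π, hπ, hu, hεL, hyρ⟩
  -- (C2) two `ε` related to the same representative are congruent modulo `U_{j+1} P`
  have hC2 : ∀ {ε ε' : Ω} {ρ' : Y}, REL ε ρ' → REL ε' ρ' →
      ∃ π₃ : Ω, IsPk π₃ ∧ w (ε * ε'⁻¹ * π₃⁻¹ - 1) ≤ w P ^ (j + 1) := by
    rintro ε ε' ρ' ⟨π, hπ, hu, hεL, hrel⟩ ⟨π', hπ', hu', hε'L, hrel'⟩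
    have hdiff := Δ.sub_mem hrel hrel'
    rw [show ∀ a b c : Y, a - a₀ - c - (b - a₀ - c) = a - b by intro a b c; abel] at hdiff
    obtain ⟨π₅, hπ₅, h5, hd⟩ := (hΔmem _).mp hdiff
    rw [AddSubgroup.coe_sub] at hd
    exact hB hπ hπ' hπ₅ hε'L hεL hu hu' h5 hd
  -- the set `T` of representatives: one admissible `ε` per representative hit
  let g : Y → Ω := fun ρ' ↦
    if h : ∃ ε : Ω, (ε ∈ L ∧ w (ε - 1) ≤ w P) ∧ REL ε ρ' then h.choose else 1
  have hg : ∀ ρ', (g ρ' ∈ L ∧ w (g ρ' - 1) ≤ w P) ∧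
      ((∃ ε : Ω, (ε ∈ L ∧ w (ε - 1) ≤ w P) ∧ REL ε ρ') → REL (g ρ') ρ') := by
    intro ρ'
    by_cases h : ∃ ε : Ω, (ε ∈ L ∧ w (ε - 1) ≤ w P) ∧ REL ε ρ'
    · simp only [g, dif_pos h]
      exact ⟨h.choose_spec.1, fun _ ↦ h.choose_spec.2⟩
    · simp only [g, dif_neg h]
      exact ⟨⟨L.one_mem, by rw [sub_self, map_zero]; exact zero_le⟩, fun h' ↦ absurd h' h⟩
  refine ⟨Rep.image g, (Finset.card_image_le).trans (hRep.trans hkerT), fun t ht ↦ ?_, ?_⟩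
  · obtain ⟨ρ', -, rfl⟩ := Finset.mem_image.mp ht
    exact (hg ρ').1
  · intro ε hεL hε1 hcond hequiv
    obtain ⟨ρ', hρ', hrel⟩ := hC1 ε hεL hcond hequiv
    have hrel' : REL (g ρ') ρ' := (hg ρ').2 ⟨ε, ⟨hεL, hε1⟩, hrel⟩
    obtain ⟨π₃, hπ₃, h3⟩ := hC2 hrel hrel'
    exact ⟨g ρ', Finset.mem_image.mpr ⟨ρ', hρ', rfl⟩, π₃, hπ₃, h3⟩

include hp1 hp0 hdisc hFw hFL hq hn hres_add hres_lt hres_F hres_L hpow_add in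
/-- **Level-by-level count.** For `j ≥ 1` there is a set `R_j ⊆ U_1 ∩ L` with `#R_j ≤ q^{j-1}`
such that every principal unit `ε ∈ L` with `F(ε) ε^{-e} ∈ U_j P` is `≡ r (mod U_j P)` for some
`r ∈ R_j` (induction on `j` with `exists_finset_fibre`). Serre, *Local Fields*, XIV §4.
[cite: SerreLocalFields1979, Ch. XIV §4] -/
theorem exists_finset_level (j : ℕ) (hj : 1 ≤ j) :
    ∃ R : Finset Ω, R.card ≤ q ^ (j - 1) ∧ (∀ r ∈ R, r ∈ L ∧ w (r - 1) ≤ w (p : Ω)) ∧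
      ∀ ε : Ω, ε ∈ L → w (ε - 1) ≤ w (p : Ω) →
        (∃ π : Ω, (∃ γ ∈ L, w γ = 1 ∧ γ ^ p ^ m = π) ∧
          w (F ε * (ε ^ e)⁻¹ * π⁻¹ - 1) ≤ w (p : Ω) ^ j) →
          ∃ r ∈ R, ∃ π : Ω, (∃ γ ∈ L, w γ = 1 ∧ γ ^ p ^ m = π) ∧
            w (ε * r⁻¹ * π⁻¹ - 1) ≤ w (p : Ω) ^ j := by
  induction j, hj using Nat.le_induction with
  | base =>
    refine ⟨{1}, by simp, fun r hr ↦ ?_, fun ε hεL hε1 _ ↦ ⟨1, Finset.mem_singleton_self _, 1,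
      isPk_one w L p m, ?_⟩⟩
    · rw [Finset.mem_singleton] at hr; subst hr
      exact ⟨L.one_mem, by rw [sub_self, map_zero]; exact zero_le⟩
    · rwa [inv_one, mul_one, mul_one, pow_one]
  | succ j hj ih =>
    obtain ⟨R, hRcard, hR, hRcov⟩ := ih
    have hfib : ∀ r : Ω, r ∈ L → w (r - 1) ≤ w (p : Ω) → ∃ T : Finset Ω, T.card ≤ q ∧
        (∀ t ∈ T, t ∈ L ∧ w (t - 1) ≤ w (p : Ω)) ∧
        ∀ ε : Ω, ε ∈ L → w (ε - 1) ≤ w (p : Ω) →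
          (∃ π : Ω, (∃ γ ∈ L, w γ = 1 ∧ γ ^ p ^ m = π) ∧
            w (F ε * (ε ^ e)⁻¹ * π⁻¹ - 1) ≤ w (p : Ω) ^ (j + 1)) →
          (∃ π : Ω, (∃ γ ∈ L, w γ = 1 ∧ γ ^ p ^ m = π) ∧ w (ε * r⁻¹ * π⁻¹ - 1) ≤ w (p : Ω) ^ j) →
            ∃ t ∈ T, ∃ π : Ω, (∃ γ ∈ L, w γ = 1 ∧ γ ^ p ^ m = π) ∧
              w (ε * t⁻¹ * π⁻¹ - 1) ≤ w (p : Ω) ^ (j + 1) := fun r hrL hr ↦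
      exists_finset_fibre w L p hp1 hp0 hdisc F hFw hFL res q n hq hn hres_add hres_lt hres_F hres_L
        hpow_add m e hj hrL hr
    choose Tf hTcard hTmem hTcov using hfib
    let R' : Finset Ω := R.attach.biUnion fun x ↦ Tf x.1 (hR x.1 x.2).1 (hR x.1 x.2).2
    refine ⟨R', ?_, fun t ht ↦ ?_, fun ε hεL hε1 hcond ↦ ?_⟩
    · calc R'.card ≤ ∑ x ∈ R.attach, (Tf x.1 (hR x.1 x.2).1 (hR x.1 x.2).2).card :=
            Finset.card_biUnion_le
        _ ≤ ∑ _x ∈ R.attach, q := Finset.sum_le_sum fun x _ ↦ hTcard _ _ _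
        _ = R.card * q := by rw [Finset.sum_const, Finset.card_attach, smul_eq_mul]
        _ ≤ q ^ (j - 1) * q := Nat.mul_le_mul_right q hRcard
        _ = q ^ (j + 1 - 1) := by
            rw [← pow_succ, show j - 1 + 1 = j + 1 - 1 by omega]
    · obtain ⟨x, -, hx⟩ := Finset.mem_biUnion.mp ht
      exact hTmem _ _ _ t hx
    · obtain ⟨πc, hπc, hc⟩ := hcond
      have hcond' : ∃ π : Ω, (∃ γ ∈ L, w γ = 1 ∧ γ ^ p ^ m = π) ∧
          w (F ε * (ε ^ e)⁻¹ * π⁻¹ - 1) ≤ w (p : Ω) ^ j :=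
        ⟨πc, hπc, hc.trans (pow_le_pow_right_of_le_one' hp1.le (by omega))⟩
      obtain ⟨r, hr, hequiv⟩ := hRcov ε hεL hε1 hcond'
      obtain ⟨t, ht, hfin⟩ := hTcov r (hR r hr).1 (hR r hr).2 ε hεL hε1 ⟨πc, hπc, hc⟩ hequiv
      exact ⟨t, Finset.mem_biUnion.mpr ⟨⟨r, hr⟩, Finset.mem_attach _ _, ht⟩, hfin⟩

variable (hcomplete : ∀ (ρ : ℝ≥0), ρ < 1 → ∀ x : ℕ → Ω, (∀ r, x r ∈ L) →
    (∀ r, w (x (r + 1) - x r) ≤ ρ ^ (r + 1)) → ∃ y ∈ L, ∀ r, w (y - x r) ≤ ρ ^ (r + 1))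

include hp1 hp0 hdisc hFw hFL hq hn hres_add hres_lt hres_F hres_L hpow_add hcomplete in
/-- **The count for principal units.** There is `R ⊆ U_1 ∩ L` with `#R ≤ q^{m+1}` such that
every principal unit `ε ∈ L` whose twist `F(ε) ε^{-e}` is a `p^m`-th power of a unit of `L` lies in
`r · P` for some `r ∈ R` (level `m + 2` of `exists_finset_level`, and `U_{m+2} ⊆ P` by
`exists_pow_prime_pow_eq_of_val_sub_one_le`). Serre, *Local Fields*, XIV §4.
[cite: SerreLocalFields1979, Ch. XIV §4] -/
theorem exists_finset_principal_units :
    ∃ R : Finset Ω, R.card ≤ q ^ (m + 1) ∧ (∀ r ∈ R, r ∈ L ∧ w (r - 1) ≤ w (p : Ω)) ∧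
      ∀ ε : Ω, ε ∈ L → w (ε - 1) ≤ w (p : Ω) →
        (∃ γ ∈ L, w γ = 1 ∧ γ ^ p ^ m = F ε * (ε ^ e)⁻¹) →
          ∃ r ∈ R, ∃ γ ∈ L, w γ = 1 ∧ γ ^ p ^ m = ε * r⁻¹ := by
  obtain ⟨R, hRcard, hR, hRcov⟩ := exists_finset_level w L p hp1 hp0 hdisc F hFw hFL res q n hq hn
    hres_add hres_lt hres_F hres_L hpow_add m e (m + 2) (by omega)
  refine ⟨R, by rwa [show m + 2 - 1 = m + 1 by omega] at hRcard, hR, fun ε hεL hε1 hγ ↦ ?_⟩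
  have hρ2 : w (p : Ω) ^ 2 < 1 := pow_lt_one₀ zero_le hp1 (by omega)
  -- `F(ε) ε^{-e} ∈ P ⊆ U_{m+2} P`
  have hx1 : w (F ε * (ε ^ e)⁻¹) = 1 := (val_eq_one_of_isPk w L p m hγ).1
  have hx0 : F ε * (ε ^ e)⁻¹ ≠ 0 := (val_eq_one_of_isPk w L p m hγ).2.2
  obtain ⟨r, hr, π, hπ, hrπ⟩ := hRcov ε hεL hε1 ⟨F ε * (ε ^ e)⁻¹, hγ, by
    rw [mul_inv_cancel₀ hx0, sub_self, map_zero]; exact zero_le⟩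
  obtain ⟨hπ1, hπL, hπ0⟩ := val_eq_one_of_isPk w L p m hπ
  -- `ε r⁻¹ π⁻¹ ∈ U_{m+2} ⊆ P`
  have hmemL : ε * r⁻¹ * π⁻¹ ∈ L :=
    L.mul_mem (L.mul_mem hεL (L.inv_mem (hR r hr).1)) (L.inv_mem hπL)
  obtain ⟨x, hxL, hx2, hxpow⟩ := exists_pow_prime_pow_eq_of_val_sub_one_le w L p hp1 hp0 hcomplete
    m hmemL hrπ
  have hxw : w x = 1 := val_eq_one_of_val_sub_one_lt w (hx2.trans_lt hρ2)
  obtain ⟨γ, hγL, hγ1, hγπ⟩ := hπ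
  refine ⟨r, hr, x * γ, L.mul_mem hxL hγL, by rw [map_mul, hxw, hγ1, one_mul], ?_⟩
  rw [mul_pow, hxpow, hγπ, inv_mul_cancel_right₀ hπ0]

variable (hres_mul : ∀ x y, w x ≤ 1 → w y ≤ 1 → res (x * y) = res x * res y) (hpq : p ∣ q)
  (hprime : p.Prime)

include hres_mul hres_lt in
/-- `res 1 = 1`. [folklore] -/
theorem res_one : res 1 = 1 := by
  have h1 : res 1 ≠ 0 := fun h ↦ by
    have := (hres_lt 1 (by rw [map_one])).mp h
    rw [map_one] at this; exact lt_irrefl _ this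
  have h := hres_mul 1 1 (by rw [map_one]) (by rw [map_one])
  rw [mul_one] at h
  exact (mul_eq_left₀ h1).mp h.symm

include hdisc hq hres_add hres_lt hres_L hres_mul in
/-- **Units to principal units**: for a unit `ε` of `L`, `ε^{qⁿ-1}` is a principal unit (the
residue of `ε` lies in `𝔽_{qⁿ}^×`). Serre, *Local Fields*, IV §4 Prop. 16.
[cite: SerreLocalFields1979, Ch. IV §4 Prop. 16] -/
theorem val_pow_sub_one_le_of_unit {ε : Ω} (hεL : ε ∈ L) (hε : w ε = 1) :
    w (ε ^ (q ^ n - 1) - 1) ≤ w (p : Ω) := by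
  have hε1 : w ε ≤ 1 := hε.le
  have hres0 : res ε ≠ 0 := fun h ↦ by
    have := (hres_lt ε hε1).mp h; rw [hε] at this; exact lt_irrefl _ this
  have hpow : ∀ j : ℕ, res (ε ^ j) = res ε ^ j := fun j ↦ by
    induction j with
    | zero => rw [pow_zero, pow_zero, res_one w res hres_lt hres_mul]
    | succ j ih =>
      rw [pow_succ, hres_mul _ _ (by rw [map_pow, hε, one_pow]) hε1, ih, pow_succ]
  have hqn1 : 1 ≤ q ^ n := Nat.one_le_pow n q (by omega)
  have hN : res (ε ^ (q ^ n - 1)) = 1 := by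
    rw [hpow]
    have h := hres_L ε hεL hε1
    conv_lhs at h => rw [← Nat.sub_add_cancel hqn1, pow_succ]
    exact (mul_eq_right₀ hres0).mp h
  have hneg1 : res (-1 : Ω) = -1 := by
    have h := hres_add 1 (-1) (by rw [map_one]) (by rw [Valuation.map_neg, map_one])
    rw [add_neg_cancel, res_zero w res hres_lt, res_one w res hres_lt hres_mul] at h
    exact (neg_eq_of_add_eq_zero_right h.symm).symm
  have hval : w (ε ^ (q ^ n - 1)) ≤ 1 := by rw [map_pow, hε, one_pow]
  have hlt : w (ε ^ (q ^ n - 1) - 1) < 1 := by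
    have hle : w (ε ^ (q ^ n - 1) - 1) ≤ 1 :=
      (Valuation.map_sub w _ _).trans (max_le hval (by rw [map_one]))
    rw [← hres_lt _ hle, sub_eq_add_neg, hres_add _ _ hval (by rw [Valuation.map_neg, map_one]),
      hN, hneg1, add_neg_cancel]
  exact hdisc _ (L.sub_mem (L.pow_mem hεL _) L.one_mem) hlt

include hp1 hp0 hdisc hFw hFL hq hn hres_add hres_lt hres_F hres_L hpow_add hcomplete hres_mul hpq
  hprime in
/-- **The count for units.** There is `R ⊆ U_1 ∩ L` with `#R ≤ q^{m+1}` such that every unit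
`ε` of `L` whose twist `F(ε) ε^{-e}` is a `p^m`-th power of a unit lies in `r · P` for some `r ∈ R`
(`ε ≡ (ε^{qⁿ-1})^a (mod P)` with `a(qⁿ - 1) + b p^m = 1`). Serre, *Local Fields*, XIV §4.
[cite: SerreLocalFields1979, Ch. XIV §4] -/
theorem exists_finset_units :
    ∃ R : Finset Ω, R.card ≤ q ^ (m + 1) ∧ (∀ r ∈ R, r ∈ L ∧ w (r - 1) ≤ w (p : Ω)) ∧
      ∀ ε : Ω, ε ∈ L → w ε = 1 →
        (∃ γ ∈ L, w γ = 1 ∧ γ ^ p ^ m = F ε * (ε ^ e)⁻¹) →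
          ∃ r ∈ R, ∃ γ ∈ L, w γ = 1 ∧ γ ^ p ^ m = ε * r⁻¹ := by
  obtain ⟨R, hRcard, hR, hRcov⟩ := exists_finset_principal_units w L p hp1 hp0 hdisc F hFw hFL res q n
    hq hn hres_add hres_lt hres_F hres_L hpow_add m e hcomplete
  refine ⟨R, hRcard, hR, fun ε hεL hε hγ ↦ ?_⟩
  have hε0 : ε ≠ 0 := fun h ↦ by rw [h, map_zero] at hε; exact zero_ne_one hε
  -- Bezout: `a (qⁿ - 1) + b p^m = 1`
  set N : ℕ := q ^ n - 1 with hNdef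
  have hqn1 : 1 ≤ q ^ n := Nat.one_le_pow n q (by omega)
  have hndvd : ¬ p ∣ N := fun h ↦ by
    have h1 : p ∣ q ^ n := hpq.trans (dvd_pow_self q hn)
    have h2 : p ∣ q ^ n - N := Nat.dvd_sub h1 h
    rw [hNdef, Nat.sub_sub_self hqn1] at h2
    exact hprime.one_lt.ne' (Nat.dvd_one.mp h2)
  have hcop : IsCoprime (N : ℤ) ((p ^ m : ℕ) : ℤ) :=
    Nat.isCoprime_iff_coprime.mpr
      (Nat.Coprime.pow_right _ ((Nat.Prime.coprime_iff_not_dvd hprime).mpr hndvd).symm)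
  obtain ⟨a, b, hab⟩ := hcop
  -- `ε = ε₁ π₁`, `ε₁ = (ε^N)^a` a principal unit, `π₁ = (ε^b)^{p^m} ∈ P`
  set ε₁ : Ω := (ε ^ N) ^ a with hε₁def
  set π₁ : Ω := (ε ^ b) ^ p ^ m with hπ₁def
  have hε₁L : ε₁ ∈ L := L.zpow_mem (L.pow_mem hεL N) a
  have hπ₁ : ∃ γ ∈ L, w γ = 1 ∧ γ ^ p ^ m = π₁ :=
    ⟨ε ^ b, L.zpow_mem hεL b, by rw [map_zpow₀, hε, one_zpow], rfl⟩
  obtain ⟨hπ₁w, hπ₁L, hπ₁0⟩ := val_eq_one_of_isPk w L p m hπ₁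
  have hεeq : ε = ε₁ * π₁ := by
    rw [hε₁def, hπ₁def, ← zpow_natCast (ε ^ b), ← zpow_natCast ε N, ← zpow_mul, ← zpow_mul,
      ← zpow_add₀ hε0, show (N : ℤ) * a + b * ((p ^ m : ℕ) : ℤ) = 1 by rw [← hab]; ring, zpow_one]
  have hε₁1 : w (ε₁ - 1) ≤ w (p : Ω) := by
    rw [hε₁def]
    exact val_zpow_sub_one_le w hp1
      (val_pow_sub_one_le_of_unit w L p hdisc res q n hq hres_add hres_lt hres_L hres_mul hεL hε) a
  have hε₁eq : ε₁ = ε * π₁⁻¹ := by rw [hεeq, mul_inv_cancel_right₀ hπ₁0]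
  -- the twist of `ε₁` is again in `P`
  have hγ₁ : ∃ γ ∈ L, w γ = 1 ∧ γ ^ p ^ m = F ε₁ * (ε₁ ^ e)⁻¹ := by
    have h := isPk_mul w L p m hγ (isPk_twist w L p F hFw hFL m e (isPk_inv w L p m hπ₁))
    have e1 : F ε * (ε ^ e)⁻¹ * (F π₁⁻¹ * (π₁⁻¹ ^ e)⁻¹) = F ε₁ * (ε₁ ^ e)⁻¹ := by
      rw [hε₁eq, map_mul, mul_zpow, mul_inv]; ring
    rwa [e1] at h
  obtain ⟨r, hr, γ', hγ'L, hγ'1, hγ'pow⟩ := hRcov ε₁ hε₁L hε₁1 hγ₁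
  refine ⟨r, hr, γ' * ε ^ b, L.mul_mem hγ'L (L.zpow_mem hεL b), by
    rw [map_mul, hγ'1, map_zpow₀, hε, one_zpow, mul_one], ?_⟩
  rw [mul_pow, hγ'pow]
  conv_rhs => rw [hεeq, hπ₁def]
  ring

include hp1 hp0 hdisc hFw hFL hq hn hres_add hres_lt hres_F hres_L hpow_add hcomplete hres_mul hpq
  hprime in
/-- **The twisted Kummer count in an unramified layer.** Let `L` be a subfield of the valued field
`(Ω, w)` on which the prime `p` is a uniformiser (`|x| < 1 ⇒ |x| ≤ |p|` on `L`, `0 < |p| < 1`),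
complete in the sense of `hcomplete`, stable under the isometric ring endomorphism `F` of `Ω`, with a
residue map `res` (additive and multiplicative on integral elements, kernel the elements of
valuation `< 1`) such that `res ∘ F = (res ·)^q` and the residues of `L` lie in `𝔽_{qⁿ}`
(`q ≥ 2`, `p ∣ q`). Then for every integer `e` and `m ≥ 0` there is a finite set `R ⊆ L^×` with
`#R ≤ N · q^{m+1}`, `N = #{0 ≤ i < p^m : p^m ∣ (e - 1) i}`, such that every `α ∈ L^×` with
`F(α) α^{-e} ∈ (L^×)^{p^m}` is `r β^{p^m}` for some `r ∈ R` and `β ∈ L^×`. (In the application: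
`Ω = K̄_v`, `L = K_v(ζ_{qⁿ-1})`, `F` an arithmetic Frobenius, `e` the unit by which `F` acts on
`Ẽ[p^m]`; this bounds `#H¹(K_v, C[p^m])` for the formal-group torsion `C` of an ordinary curve.)
Serre, *Local Fields*, XIV §4; Greenberg, LNM 1716, §2 Prop. 2.2 (p. 73).
[cite: SerreLocalFields1979, Ch. XIV §4] [cite: GreenbergLNM1716, §2 Prop. 2.2 (proof, p. 73)] -/
theorem exists_finset_forall_frobenius_zpow_rep :
    ∃ R : Finset Ω,
      R.card ≤ ((Finset.range (p ^ m)).filter fun i : ℕ ↦ ((p ^ m : ℕ) : ℤ) ∣ (e - 1) * i).card *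
        q ^ (m + 1) ∧
      (∀ r ∈ R, r ∈ L ∧ r ≠ 0) ∧
      ∀ α : Ω, α ∈ L → α ≠ 0 → (∃ β ∈ L, β ≠ 0 ∧ F α * (α ^ e)⁻¹ = β ^ p ^ m) →
        ∃ r ∈ R, ∃ β ∈ L, β ≠ 0 ∧ α = r * β ^ p ^ m := by
  obtain ⟨R, hRcard, hR, hRcov⟩ := exists_finset_units w L p hp1 hp0 hdisc F hFw hFL res q n hq hn
    hres_add hres_lt hres_F hres_L hpow_add m e hcomplete hres_mul hpq hprime
  set P : Ω := (p : Ω) with hPdef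
  have hp0' : P ≠ 0 := natCast_prime_ne_zero w p hp0
  have hPL : P ∈ L := natCast_mem L p
  have hpm0 : ((p ^ m : ℕ) : ℤ) ≠ 0 := by exact_mod_cast pow_ne_zero m hprime.ne_zero
  set I : Finset ℕ := (Finset.range (p ^ m)).filter fun i : ℕ ↦ ((p ^ m : ℕ) : ℤ) ∣ (e - 1) * i
    with hIdef
  let f : ℕ × Ω → Ω := fun q' ↦ P ^ q'.1 * q'.2
  refine ⟨(I ×ˢ R).image f, ?_, fun r hr ↦ ?_, fun α hαL hα0 hβ ↦ ?_⟩
  · exact Finset.card_image_le.trans (by rw [Finset.card_product]; exact Nat.mul_le_mul_left _ hRcard)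
  · obtain ⟨⟨i, r'⟩, hir, rfl⟩ := Finset.mem_image.mp hr
    rw [Finset.mem_product] at hir
    obtain ⟨hr'L, hr'1⟩ := hR r' hir.2
    have hr'0 : r' ≠ 0 := fun h ↦ by
      rw [h, zero_sub, Valuation.map_neg, map_one] at hr'1; exact absurd hr'1 (not_le.mpr hp1)
    exact ⟨L.mul_mem (L.pow_mem hPL i) hr'L, mul_ne_zero (pow_ne_zero i hp0') hr'0⟩
  · obtain ⟨β, hβL, hβ0, hβ⟩ := hβ
    -- valuations: `|α| = |p|^v`, `|β| = |p|^u`, `(1 - e) v = p^m u`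
    obtain ⟨v, hv⟩ := exists_val_eq_zpow w L p hp1 hp0 hdisc hαL hα0
    obtain ⟨u, hu⟩ := exists_val_eq_zpow w L p hp1 hp0 hdisc hβL hβ0
    have hpne : w P ≠ 0 := hp0.ne'
    have hval : w P ^ ((1 - e) * v) = w P ^ (((p ^ m : ℕ) : ℤ) * u) := by
      have h := congrArg w hβ
      rw [map_mul, map_inv₀, map_zpow₀, hFw, hv, map_pow, hu, ← zpow_mul, ← zpow_neg, ← zpow_add₀ hpne,
        ← zpow_natCast, ← zpow_mul] at h
      convert h using 2 <;> ring
    have hdvd : ((p ^ m : ℕ) : ℤ) ∣ (e - 1) * v := by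
      have h := zpow_val_injective w p hp1 hp0 hval
      refine ⟨-u, ?_⟩
      linear_combination -h
    -- `v = p^m t + i`, `0 ≤ i < p^m`, `i ∈ I`
    set t : ℤ := v / ((p ^ m : ℕ) : ℤ) with htdef
    set i : ℤ := v % ((p ^ m : ℕ) : ℤ) with hidef
    have hvi : v = ((p ^ m : ℕ) : ℤ) * t + i := by
      have := Int.emod_def v ((p ^ m : ℕ) : ℤ)
      rw [← hidef, ← htdef] at this
      linear_combination -this
    have hi0 : 0 ≤ i := Int.emod_nonneg _ hpm0
    have hilt : i < ((p ^ m : ℕ) : ℤ) := Int.emod_lt_of_pos _ (by exact_mod_cast pow_pos hprime.pos m)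
    have hiI : i.toNat ∈ I := by
      rw [hIdef, Finset.mem_filter, Finset.mem_range]
      refine ⟨by omega, ?_⟩
      rw [Int.toNat_of_nonneg hi0]
      have : (e - 1) * i = (e - 1) * v - ((p ^ m : ℕ) : ℤ) * ((e - 1) * t) := by rw [hvi]; ring
      rw [this]
      exact dvd_sub hdvd (dvd_mul_right _ _)
    -- the unit `ε = α p^{-v}`
    set ε : Ω := α * P ^ (-v) with hεdef
    have hεL : ε ∈ L := L.mul_mem hαL (L.zpow_mem hPL _)
    have hε : w ε = 1 := by
      rw [hεdef, map_mul, map_zpow₀, hv, ← zpow_add₀ hpne, add_neg_cancel, zpow_zero]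
    -- its twist is a `p^m`-th power of a unit: `F ε ε^{-e} = (β p^s)^{p^m}`, `s = (e-1)v/p^m`
    obtain ⟨s, hs⟩ := hdvd
    have hFP : F P = P := by rw [hPdef, map_natCast]
    have htwist : F ε * (ε ^ e)⁻¹ = (β * P ^ s) ^ p ^ m := by
      calc F ε * (ε ^ e)⁻¹ = (F α * (α ^ e)⁻¹) * (P ^ (-v) * (P ^ (-v * e))⁻¹) := by
            rw [hεdef, map_mul, map_zpow₀, hFP, mul_zpow, ← zpow_mul, mul_inv]; ring
        _ = β ^ p ^ m * P ^ (((p ^ m : ℕ) : ℤ) * s) := by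
            rw [hβ, ← zpow_neg, ← zpow_add₀ hp0', show -v + -(-v * e) = (e - 1) * v by ring, hs]
        _ = (β * P ^ s) ^ p ^ m := by
            rw [mul_pow, ← zpow_natCast (P ^ s), ← zpow_mul, mul_comm s]
    have hγ : ∃ γ ∈ L, w γ = 1 ∧ γ ^ p ^ m = F ε * (ε ^ e)⁻¹ := by
      refine ⟨β * P ^ s, L.mul_mem hβL (L.zpow_mem hPL s), ?_, htwist.symm⟩
      have h1 : w (F ε * (ε ^ e)⁻¹) = 1 := by
        rw [map_mul, map_inv₀, map_zpow₀, hFw, hε, one_zpow, inv_one, mul_one]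
      rw [htwist, map_pow] at h1
      rcases lt_trichotomy (w (β * P ^ s)) 1 with hlt | heq | hgt
      · exact absurd h1 (pow_lt_one₀ zero_le hlt (pow_ne_zero m hprime.ne_zero)).ne
      · exact heq
      · exact absurd h1 (one_lt_pow₀ hgt (pow_ne_zero m hprime.ne_zero)).ne'
    obtain ⟨r, hr, γ, hγL, hγ1, hγpow⟩ := hRcov ε hεL hε hγ
    obtain ⟨hrL, hr1⟩ := hR r hr
    have hr0 : r ≠ 0 := fun h ↦ by
      rw [h, zero_sub, Valuation.map_neg, map_one] at hr1; exact absurd hr1 (not_le.mpr hp1)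
    have hγ0 : γ ≠ 0 := fun h ↦ by rw [h, map_zero] at hγ1; exact zero_ne_one hγ1
    -- `α = (p^i r) · (γ p^t)^{p^m}`
    refine ⟨f (i.toNat, r), Finset.mem_image.mpr ⟨(i.toNat, r), Finset.mem_product.mpr ⟨hiI, hr⟩, rfl⟩,
      γ * P ^ t, L.mul_mem hγL (L.zpow_mem hPL t), mul_ne_zero hγ0 (zpow_ne_zero t hp0'), ?_⟩
    change α = P ^ i.toNat * r * (γ * P ^ t) ^ p ^ m
    have hα : α = ε * P ^ v := by
      rw [hεdef, mul_assoc, ← zpow_add₀ hp0', neg_add_cancel, zpow_zero, mul_one]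
    rw [hα, mul_pow, hγpow, ← zpow_natCast (P ^ t), ← zpow_mul, ← zpow_natCast P i.toNat,
      Int.toNat_of_nonneg hi0, hvi]
    rw [zpow_add₀ hp0']
    field_simp
    ring

end Count

end Literature.NumberTheory.EllipticCurves.TwistedKummer

/-! ## §6 The layers `K_v(ζ_{qⁿ-1}) ⊆ K̄_v` of the tree

The instantiation for `Ω = K̄_v` with its spectral valuation, `L = K_v(ζ)`
(`UnramifiedLayerRootsProofs`, `UnramifiedLayerResidueProofs`), an arithmetic Frobenius
`F ∈ Γ_{K_v}` and the residue map of `exists_residueMap`, at a place `v ∣ p` at which `p` is a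
uniformiser of `𝓞_v` (`v` unramified over `p`; every place of `ℚ`). -/




namespace IsDedekindDomain.HeightOneSpectrum

open Literature.NumberTheory.EllipticCurves Literature.NumberTheory.GaloisRepresentations Field
  Literature.NumberTheory.EllipticCurves.TwistedKummer

variable {K : Type u} [Field K] [NumberField K] {v : HeightOneSpectrum (𝓞 K)}
  {w : Valuation (AlgebraicClosure (v.adicCompletion K)) ℝ≥0}
  (hw : ∀ x, (w x : ℝ) = spectralNorm (v.adicCompletion K) (AlgebraicClosure (v.adicCompletion K)) x)
  {𝔐 : Ideal v.localAbsIntegers} (h𝔐 : 𝔐 ∈ v.localPrimesAbove)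
  {F : absoluteGaloisGroup (v.adicCompletion K)}
  (hF : IsArithFrobAt (v.adicCompletionIntegers K) F 𝔐)
  {p : ℕ} [hp : Fact p.Prime] (hpv : (p : 𝓞 K) ∈ v.asIdeal)
  (hϖ : Irreducible ((p : ℕ) : v.adicCompletionIntegers K))
  {n : ℕ} (hn : n ≠ 0) {ζ : AlgebraicClosure (v.adicCompletion K)}
  (hζ : IsPrimitiveRoot ζ (Nat.card (IsLocalRing.ResidueField (v.adicCompletionIntegers K)) ^ n - 1))

include hw h𝔐 hF hpv hϖ hn hζ in
/-- **The twisted Kummer count in the layer `K_v(ζ)`.** Let `v ∣ p` be a finite place of the number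
field `K` at which `p` is a uniformiser of `𝓞_v`, `ζ ∈ K̄_v` a primitive `(qⁿ - 1)`-th root of unity
(`q = #k_v`, `n ≥ 1`), `F ∈ Γ_{K_v}` an arithmetic Frobenius, `e` an integer and `m ≥ 0`. There is a
finite set `R ⊆ K_v(ζ)^×` with `#R ≤ N · q^{m+1}`, `N = #{0 ≤ i < p^m : p^m ∣ (e - 1) i}`, such that
every `α ∈ K_v(ζ)^×` with `F(α) α^{-e} ∈ (K_v(ζ)^×)^{p^m}` is `r β^{p^m}` with `r ∈ R`,
`β ∈ K_v(ζ)^×` — the number of classes of `H¹(K_v(ζ), μ_{p^m}) = K_v(ζ)^×/(K_v(ζ)^×)^{p^m}` fixed by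
the Frobenius twisted by `e` (Serre, *Local Fields*, XIV §4, by the unit filtration; cf. Greenberg,
LNM 1716, §2 Prop. 2.2, p. 73, where the corresponding corank statement is taken from Tate's Euler
characteristic formula). [cite: SerreLocalFields1979, Ch. XIV §4]
[cite: GreenbergLNM1716, §2 Prop. 2.2 (proof, p. 73)] -/
theorem exists_finset_forall_frobenius_zpow_rep_adjoin (m : ℕ) (e : ℤ) :
    ∃ R : Finset (AlgebraicClosure (v.adicCompletion K)),
      R.card ≤ ((Finset.range (p ^ m)).filter fun i : ℕ ↦ ((p ^ m : ℕ) : ℤ) ∣ (e - 1) * i).card *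
        Nat.card (IsLocalRing.ResidueField (v.adicCompletionIntegers K)) ^ (m + 1) ∧
      (∀ r ∈ R, r ∈ IntermediateField.adjoin (v.adicCompletion K) {ζ} ∧ r ≠ 0) ∧
      ∀ α : AlgebraicClosure (v.adicCompletion K),
        α ∈ IntermediateField.adjoin (v.adicCompletion K) {ζ} → α ≠ 0 →
        (∃ β ∈ IntermediateField.adjoin (v.adicCompletion K) {ζ},
          β ≠ 0 ∧ F • α * (α ^ e)⁻¹ = β ^ p ^ m) →
        ∃ r ∈ R, ∃ β ∈ IntermediateField.adjoin (v.adicCompletion K) {ζ},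
          β ≠ 0 ∧ α = r * β ^ p ^ m := by
  -- the residue field `k_v`, `q = #k_v = p^f`
  set kv := IsLocalRing.ResidueField (v.adicCompletionIntegers K) with hkv
  haveI : Finite kv := finite_residueField_adicCompletionIntegers K v
  letI : Fintype kv := Fintype.ofFinite _
  set q : ℕ := Nat.card kv with hqdef
  have hq : 2 ≤ q := by rw [hqdef]; exact Finite.one_lt_card
  have hchar : ringChar kv = p := by
    have h0 : (p : kv) = 0 := by
      have h := (HeightOneSpectrum.residue_algebraMap_eq_zero_iff K v (p : 𝓞 K)).mpr hpv
      simpa only [map_natCast] using h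
    exact CharP.ringChar_of_prime_eq_zero hp.out h0
  haveI hcharp : CharP kv p := ringChar.of_eq hchar
  obtain ⟨f, -, hcard⟩ := FiniteField.card kv p
  have hqf : q = p ^ (f : ℕ) := by rw [hqdef, Nat.card_eq_fintype_card, hcard]
  have hpq : p ∣ q := by rw [hqf]; exact dvd_pow_self p (PNat.ne_zero f)
  haveI : CharP (AlgebraicClosure kv) p :=
    charP_of_injective_algebraMap (algebraMap kv (AlgebraicClosure kv)).injective p
  have hpow_add : ∀ a b : AlgebraicClosure kv, (a + b) ^ q = a ^ q + b ^ q := fun a b ↦ by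
    rw [hqf]; exact add_pow_char_pow a b p f
  -- `|p|_v`: `0 < |p| < 1`
  have hpcast : (algebraMap (𝓞 K) (AlgebraicClosure (v.adicCompletion K)) (p : 𝓞 K)) =
      (p : AlgebraicClosure (v.adicCompletion K)) := map_natCast _ _
  have hp1 : w (p : AlgebraicClosure (v.adicCompletion K)) < 1 := by
    have := spectralValuation_algebraMap_ringOfIntegers_lt_one hw hpv
    rwa [hpcast] at this
  haveI : CharZero (v.adicCompletion K) :=
    charZero_of_injective_algebraMap (algebraMap K (v.adicCompletion K)).injective
  haveI : CharZero (AlgebraicClosure (v.adicCompletion K)) := charZero_of_injective_algebraMap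
    (algebraMap (v.adicCompletion K) (AlgebraicClosure (v.adicCompletion K))).injective
  have hp0 : 0 < w (p : AlgebraicClosure (v.adicCompletion K)) :=
    (Valuation.pos_iff w).mpr (Nat.cast_ne_zero.mpr hp.out.ne_zero)
  -- the layer and its discreteness / completeness
  set L : Subfield (AlgebraicClosure (v.adicCompletion K)) :=
    (IntermediateField.adjoin (v.adicCompletion K) {ζ}).toSubfield with hLdef
  have hLmem : ∀ x, x ∈ L ↔ x ∈ IntermediateField.adjoin (v.adicCompletion K) {ζ} :=
    fun x ↦ Iff.rfl
  have hm0 : q ^ n - 1 ≠ 0 := residueCard_pow_sub_one_ne_zero (v := v) hn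
  have hmw : w ((q ^ n - 1 : ℕ) : AlgebraicClosure (v.adicCompletion K)) = 1 :=
    spectralValuation_natCast_residueCard_pow_sub_one hw hn
  have hζpow : ζ ^ (q ^ n - 1) = 1 := hζ.pow_eq_one
  have hdisc : ∀ x ∈ L, w x < 1 → w x ≤ w (p : AlgebraicClosure (v.adicCompletion K)) :=
      fun x hx hx1 ↦ by
    have h := spectralValuation_le_uniformizer_of_mem_adjoin hw h𝔐 hm0 hmw hζpow hϖ
      ((hLmem x).mp hx) hx1
    have e1 : algebraMap (v.adicCompletion K) (AlgebraicClosure (v.adicCompletion K))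
        ((p : v.adicCompletionIntegers K) : v.adicCompletion K) =
        (p : AlgebraicClosure (v.adicCompletion K)) := by
      rw [SubringClass.coe_natCast, map_natCast]
    rwa [e1] at h
  have hcomplete : ∀ (ρ : ℝ≥0), ρ < 1 → ∀ x : ℕ → AlgebraicClosure (v.adicCompletion K),
      (∀ r, x r ∈ L) →
      (∀ r, w (x (r + 1) - x r) ≤ ρ ^ (r + 1)) → ∃ y ∈ L, ∀ r, w (y - x r) ≤ ρ ^ (r + 1) := by
    intro ρ hρ x hxL hx
    obtain ⟨y, hy⟩ := exists_limit_of_mem_adjoin (v := v) hw hm0 hζpow hρ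
      (fun r ↦ ⟨x r, (hLmem _).mp (hxL r)⟩) hx
    exact ⟨y, (hLmem _).mpr y.2, hy⟩
  -- the Frobenius as a ring endomorphism of `AlgebraicClosure (v.adicCompletion K)`
  set Fh : AlgebraicClosure (v.adicCompletion K) →+* AlgebraicClosure (v.adicCompletion K) :=
    MulSemiringAction.toRingHom _ (AlgebraicClosure (v.adicCompletion K)) F with hFhdef
  have hFh : ∀ x, Fh x = F • x := fun x ↦ rfl
  have hFw : ∀ x, w (Fh x) = w x := fun x ↦ by rw [hFh]; exact spectralValuation_smul hw F x
  have hFζ : F • ζ = ζ ^ q := frobenius_smul_eq_pow_of_pow_eq_one hw h𝔐 hF hm0 hmw hζpow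
  have hFL : ∀ x ∈ L, Fh x ∈ L := fun x hx ↦
    (hLmem _).mpr (smul_mem_adjoin_of_smul_eq_pow hFζ ((hLmem x).mp hx))
  -- the residue function
  obtain ⟨r, hr, -, hrF⟩ := exists_residueMap (v := v) hw h𝔐
  have hrF' : ∀ (z : w.integer) (h : w (F • (z : AlgebraicClosure (v.adicCompletion K))) ≤ 1),
      r ⟨F • (z : AlgebraicClosure (v.adicCompletion K)), h⟩ = r z ^ q :=
    fun z h ↦ hrF hF z h
  let res : AlgebraicClosure (v.adicCompletion K) → AlgebraicClosure kv := fun x ↦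
    if h : w x ≤ 1 then r ⟨x, h⟩ else 0
  have hres : ∀ x (h : w x ≤ 1), res x = r ⟨x, h⟩ := fun x h ↦ dif_pos h
  have hres_add : ∀ x y, w x ≤ 1 → w y ≤ 1 → res (x + y) = res x + res y := fun x y hx hy ↦ by
    have hxy : w (x + y) ≤ 1 := (Valuation.map_add w x y).trans (max_le hx hy)
    rw [hres _ hxy, hres _ hx, hres _ hy, ← map_add]
    rfl
  have hres_mul : ∀ x y, w x ≤ 1 → w y ≤ 1 → res (x * y) = res x * res y := fun x y hx hy ↦ by
    have hxy : w (x * y) ≤ 1 := by rw [map_mul]; exact mul_le_one' hx hy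
    rw [hres _ hxy, hres _ hx, hres _ hy, ← map_mul]
    rfl
  have hres_lt : ∀ x, w x ≤ 1 → (res x = 0 ↔ w x < 1) := fun x hx ↦ by
    rw [hres _ hx]; exact hr ⟨x, hx⟩
  have hres_F : ∀ x, w x ≤ 1 → res (Fh x) = res x ^ q := fun x hx ↦ by
    have hFx : w (F • x) ≤ 1 := by rw [spectralValuation_smul hw]; exact hx
    rw [hFh, hres _ hFx, hres _ hx]
    exact hrF' ⟨x, hx⟩ hFx
  have hres_L : ∀ x ∈ L, w x ≤ 1 → res x ^ q ^ n = res x := fun x hx hx1 ↦ by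
    rw [hres _ hx1]
    exact residue_pow_card_pow_eq_of_mem_adjoin hw h𝔐 hF hrF' hn hζ ((hLmem x).mp hx) hx1
  -- the abstract count
  obtain ⟨R, hRcard, hR, hRcov⟩ := exists_finset_forall_frobenius_zpow_rep w L p hp1 hp0 hdisc Fh
    hFw hFL res q n hq hn hres_add hres_lt hres_F hres_L hpow_add m e hcomplete hres_mul hpq hp.out
  refine ⟨R, hRcard, fun r hr ↦ ⟨(hLmem r).mp (hR r hr).1, (hR r hr).2⟩, fun α hα hα0 hβ ↦ ?_⟩
  obtain ⟨β, hβL, hβ0, hβ⟩ := hβ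
  obtain ⟨r', hr', β', hβ'L, hβ'0, h⟩ := hRcov α ((hLmem α).mpr hα) hα0
    ⟨β, (hLmem β).mpr hβL, hβ0, by rw [hFh]; exact hβ⟩
  exact ⟨r', hr', β', (hLmem β').mp hβ'L, hβ'0, h⟩

end IsDedekindDomain.HeightOneSpectrum
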